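import Mathlib.Analysis.Calculus.LineDeriv.IntegrationByParts
import Mathlib.MeasureTheory.Integral.Prod
import Literature.Analysis.Calculus.ScaledCutoffFamily
import Literature.MathematicalPhysics.QuantumLattice.YangMillsStressEnergy
import HarnessLib

/-!
# The weighted energy identities of the Yang–Mills heat flow (Waldron 2019, §2, (2.5)–(2.10))

Step two of the printed proof of Waldron's Theorem 1.1 (A. Waldron, *Long-time existence for
Yang–Mills flow*, Invent. math. 217 (2019), §2 "Stress-energy identities"), on which the named
fact `Literature.MathematicalPhysics.QuantumLattice.Waldron2019_yangMillsFlow_flatTorus` rests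
(`Waldron2019_yangMillsFlow_flatTorus_of_thm11`): the whole of §2 after (2.2) in the flat
setting of the named fact — connections on a finite-dimensional real inner product space `E`
(four-dimensional where tracelessness of the stress–energy tensor is used), coefficients
`M_m(ℂ)` with the Hilbert–Schmidt inner product, `𝔲(m)`-valued classical (jointly smooth)
solutions of `∂ₜ A = div_A F = −D^*F` on an open time set `𝒯`. Notation: `e = ∑_{i<j}‖F_{ij}‖²`
(Waldron's `|F|²`), `(div F)_j = divCurvature · (b j)` (`= −(D^*F)_j`, so `|D^*F|² = ∑ⱼ‖(div F)_j‖²`),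
`S_{ij}` the stress–energy tensor (`YangMillsStressEnergy`), `r = ‖y − x₀‖`, `X_i = ⟨y − x₀, bᵢ⟩`,
`∂ᵢ∂ⱼχ(y) = fderiv (fun z => fderiv χ z bⱼ) y bᵢ`, `B_ρ = B_ρ(x₀)`, `U_λ^ρ = B̄_ρ ∖ B_λ`.

* `integral_mul_sum_fderiv_eq_neg_integral` — integration by parts against a test function,
  `∫ χ ∑ᵢ ∂_{vᵢ} fᵢ = −∫ ∑ᵢ fᵢ ∂_{vᵢ} χ`;
* `integral_mul_divergenceTerm_eq_integral_stress` — at a fixed time,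
  `∫ χ ∑ᵢⱼ ∂ᵢ⟨F_{ij}, (div F)_j⟩ = ∫ ∑ᵢⱼ S_{ij} ∂ᵢ∂ⱼχ` (two integrations by parts and (2.2));
* `integrable_prod_Ioc_of_continuousOn_of_eq_zero`, `integrable_restrict_prod_Ioc_of_continuousOn`,
  `intervalIntegrable_(set)integral_of_continuousOn` — the Fubini/integrability lemmas for time
  integrals of spatial integrals of slab-continuous integrands;
* `weightedEnergy_sub_eq_of_flow_on` — **(2.5)** integrated in time: for `χ ∈ C²_c(E)`,
  `∫ χ e(t₂) − ∫ χ e(t₁) = −2∫_{t₁}^{t₂}∫ χ|div F|² + 2∫_{t₁}^{t₂}∫ ∑ᵢⱼ S_{ij}∂ᵢ∂ⱼχ`;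
* `fderiv_fderiv_halfNormSq_mul`, `sum_sum_mul_fderiv_fderiv_halfNormSq_mul` — the computation
  `∇ⁱ∇ʲ(½r²φ) = g^{ij}φ + Xⁱ∇ʲφ + Xʲ∇ⁱφ + ½r²∇ⁱ∇ʲφ` and its contraction with a symmetric
  trace-free tensor ((2.8), flat case);
* `weightedEnergy_rsq_identity_of_flow_on` — **(2.9)**, the localized and weighted energy
  identity `∫ e(τ₂)φr² + 2∫∫|div F|²φr² = ∫ e(τ₁)φr² + S(φ,τ₁,τ₂)` with
  `S(φ,τ₁,τ₂) = 4∫_{τ₁}^{τ₂}∫ ∑ᵢⱼ S_{ij}(2Xᵢ∂ⱼφ + ½r²∂ᵢ∂ⱼφ)` (Waldron's `S(λ,τ₁,τ₂)` of (2.6) for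
  the radial cut-off `φ_λ`);
* `abs_stressWeight_le_indicator`, `abs_stressWeight_integral_le` — **the obvious bound (2.7)**
  `|S(φ,τ₁,τ₂)| ≤ C∫_{τ₁}^{τ₂}∫_{U_λ^{2λ}} e` for cut-offs with `‖Dφ‖ ≤ c₁/λ`, `‖D²φ‖ ≤ c₂/λ²`;
  `exists_cutoff_stressWeight_le` — the cut-off family `φ_λ` of (2.6) with (2.7)
  (from `Literature.Analysis.Calculus.exists_smooth_cutoff_family`);
* `Waldron2019_lemma_2_1` — **Lemma 2.1** (concentration from scale `λ₁` to
  `λ₂ = (λ₁/10)√(ε/E)` forces dissipation `∫∫_{B_{2λ₁}}|D^*F|² > ε/100`);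
  `Waldron2019_lemma_2_1_torus` — its last sentence on the flat torus
  (`YM(τ₂) + ε/100 < YM(τ₁)`, (2.10)).

References: A. Waldron, *Long-time existence for Yang–Mills flow*, Invent. math. 217 (2019),
1069–1147, §2 (2.4)–(2.10), Lemma 2.1 [Waldron2019].
-/

noncomputable section

open scoped ContDiff Topology RealInnerProductSpace Matrix
open Set Filter MeasureTheory Metric

namespace Literature.MathematicalPhysics.QuantumLattice

/-! ### Integration by parts against a test function -/

section TestFunctionIBP

variable {E : Type*} [NormedAddCommGroup E] [InnerProductSpace ℝ E]

/-- Off the topological support of `χ`, the second directional derivatives of `χ` vanish.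
[folklore] -/
theorem fderiv_fderiv_apply_eq_zero_of_notMem_tsupport {χ : E → ℝ} {y : E}
    (hy : y ∉ tsupport χ) (u v : E) :
    fderiv ℝ (fun z => fderiv ℝ χ z v) y u = 0 := by
  have h0 : χ =ᶠ[𝓝 y] fun _ => 0 := by
    have hopen : IsOpen (tsupport χ)ᶜ := (isClosed_tsupport χ).isOpen_compl
    filter_upwards [hopen.mem_nhds hy] with z hz
    exact image_eq_zero_of_notMem_tsupport hz
  have h1 : (fun z => fderiv ℝ χ z v) =ᶠ[𝓝 y] fun _ => 0 := by
    filter_upwards [h0.eventually_nhds] with z hz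
    have hz' : χ =ᶠ[𝓝 z] fun _ => 0 := hz
    simp only [hz'.fderiv_eq, fderiv_const_apply, zero_apply]
  simp only [h1.fderiv_eq, fderiv_const_apply, zero_apply]

/-- Off the topological support of `χ`, the first derivative of `χ` vanishes. [folklore] -/
theorem fderiv_eq_zero_of_notMem_tsupport {χ : E → ℝ} {y : E} (hy : y ∉ tsupport χ) :
    fderiv ℝ χ y = 0 := by
  have h0 : χ =ᶠ[𝓝 y] fun _ => 0 := by
    have hopen : IsOpen (tsupport χ)ᶜ := (isClosed_tsupport χ).isOpen_compl
    filter_upwards [hopen.mem_nhds hy] with z hz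
    exact image_eq_zero_of_notMem_tsupport hz
  rw [h0.fderiv_eq]
  exact fderiv_const_apply 0

variable [FiniteDimensional ℝ E] [MeasurableSpace E] [BorelSpace E]

/-- **Integration by parts against a test function.** For `C¹` functions `fᵢ` and a `C¹`
compactly supported `χ` on a finite-dimensional inner product space,
`∫ χ ∑ᵢ ∂_{vᵢ} fᵢ = −∫ ∑ᵢ fᵢ ∂_{vᵢ} χ` (Lebesgue measure). [folklore] -/
theorem integral_mul_sum_fderiv_eq_neg_integral {κ : Type*} [Fintype κ] (v : κ → E)
    {χ : E → ℝ} {f : κ → E → ℝ} (hχ : ContDiff ℝ 1 χ) (hχc : HasCompactSupport χ)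
    (hf : ∀ i, ContDiff ℝ 1 (f i)) :
    ∫ y, χ y * ∑ i, fderiv ℝ (f i) y (v i) = -∫ y, ∑ i, f i y * fderiv ℝ χ y (v i) := by
  have hχcont : Continuous χ := hχ.continuous
  have hdχcont : ∀ i, Continuous fun y => fderiv ℝ χ y (v i) := fun i =>
    (hχ.continuous_fderiv one_ne_zero).clm_apply continuous_const
  have hfcont : ∀ i, Continuous (f i) := fun i => (hf i).continuous
  have hdfcont : ∀ i, Continuous fun y => fderiv ℝ (f i) y (v i) := fun i =>
    ((hf i).continuous_fderiv one_ne_zero).clm_apply continuous_const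
  -- integrability of the three pairings (continuous with compact support)
  have hint1 : ∀ i, Integrable (fun y => fderiv ℝ χ y (v i) * f i y) := fun i =>
    ((hdχcont i).mul (hfcont i)).integrable_of_hasCompactSupport
      ((hχc.fderiv_apply (𝕜 := ℝ) (v i)).mul_right)
  have hint2 : ∀ i, Integrable (fun y => χ y * fderiv ℝ (f i) y (v i)) := fun i =>
    (hχcont.mul (hdfcont i)).integrable_of_hasCompactSupport hχc.mul_right
  have hint3 : ∀ i, Integrable (fun y => χ y * f i y) := fun i =>
    (hχcont.mul (hfcont i)).integrable_of_hasCompactSupport hχc.mul_right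
  -- integration by parts in each direction
  have hibp : ∀ i, ∫ y, χ y * fderiv ℝ (f i) y (v i) = -∫ y, fderiv ℝ χ y (v i) * f i y :=
    fun i => integral_mul_fderiv_eq_neg_fderiv_mul_of_integrable (hint1 i) (hint2 i) (hint3 i)
      (fun y _ => (hχ.differentiable one_ne_zero) y) (fun y _ => ((hf i).differentiable one_ne_zero) y)
  calc ∫ y, χ y * ∑ i, fderiv ℝ (f i) y (v i)
      = ∫ y, ∑ i, χ y * fderiv ℝ (f i) y (v i) := by simp_rw [Finset.mul_sum]
    _ = ∑ i, ∫ y, χ y * fderiv ℝ (f i) y (v i) := integral_finsetSum _ fun i _ => hint2 i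
    _ = ∑ i, -∫ y, fderiv ℝ χ y (v i) * f i y := Finset.sum_congr rfl fun i _ => hibp i
    _ = -∫ y, ∑ i, f i y * fderiv ℝ χ y (v i) := by
        rw [integral_finsetSum _ fun i _ => ?_, ← Finset.sum_neg_distrib]
        · refine Finset.sum_congr rfl fun i _ => ?_
          congr 1
          refine integral_congr_ae (ae_of_all _ fun y => ?_)
          exact mul_comm _ _
        · simpa only [mul_comm] using hint1 i

end TestFunctionIBP

/-! ### Regularity of the covariant divergence -/

section DivRegularity

variable {E : Type*} [NormedAddCommGroup E] [InnerProductSpace ℝ E] [FiniteDimensional ℝ E]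
variable {𝔸 : Type*} [NormedRing 𝔸] [NormedAlgebra ℝ 𝔸]

/-- For a `C^{k+2}` connection, `y ↦ div_A F_A(y)(v)` is `C^k`. [folklore] -/
theorem contDiff_divCurvature_apply {k : WithTop ℕ∞} {A : Connection E 𝔸}
    (hA : ContDiff ℝ (k + 2) A) (v : E) : ContDiff ℝ k (fun y => divCurvature A y v) := by
  unfold divCurvature
  exact ContDiff.sum fun i _ => contDiff_covDeriv_curvature_apply hA _ v _

end DivRegularity

/-! ### The stress–energy form of the divergence term -/

section StressForm

open scoped Matrix.Norms.Frobenius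

attribute [local instance] frobeniusInnerProductSpace

variable {m : Type*} [Fintype m] [DecidableEq m]
variable {E : Type*} [NormedAddCommGroup E] [InnerProductSpace ℝ E] [FiniteDimensional ℝ E]
  [MeasurableSpace E] [BorelSpace E]
variable {ι : Type*} [Fintype ι] [LinearOrder ι]

/-- **Two integrations by parts** (Waldron 2019, (2.4)–(2.5)). For a smooth `𝔲(m)`-valued
connection `B` and a `C²` compactly supported weight `χ`,
`∫ χ ∑ᵢⱼ ∂ᵢ ⟨F_{ij}, (div F)_j⟩ = ∫ ∑ᵢⱼ S_{ij} ∂ᵢ∂ⱼ χ`: the energy flux `Wᵢ = ∑ⱼ ⟨F_{ij}, (div F)_j⟩`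
is the divergence `∑_k ∂_k S_{ki}` of the stress–energy tensor
(`sum_inner_curvature_divCurvature_eq_sum_fderiv_ymStressEnergyOfBasis`), and both derivatives
are moved onto `χ`. Here `∂ᵢ∂ⱼχ(y) = fderiv (fun z => fderiv χ z bⱼ) y bᵢ`.
[cite: Waldron2019, §2 (2.4)–(2.5)] -/
theorem integral_mul_divergenceTerm_eq_integral_stress (b : OrthonormalBasis ι ℝ E)
    {B : Connection E (Matrix m m ℂ)} (hB : ContDiff ℝ ∞ B)
    (hval : B.IsValuedIn (skewAdjoint.submodule ℝ (Matrix m m ℂ)))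
    {χ : E → ℝ} (hχ : ContDiff ℝ 2 χ) (hχc : HasCompactSupport χ) :
    ∫ y, χ y * ∑ i, ∑ j, fderiv ℝ (fun z => ⟪curvature B z (b i) (b j),
        divCurvature B z (b j)⟫) y (b i) =
      ∫ y, ∑ i, ∑ j, ymStressEnergyOfBasis b B y i j *
        fderiv ℝ (fun z => fderiv ℝ χ z (b j)) y (b i) := by
  have hB2 : ContDiff ℝ 2 B := hB.of_le ENat.LEInfty.out
  have hB3 : ContDiff ℝ 3 B := hB.of_le ENat.LEInfty.out
  have hB21 : ContDiff ℝ (2 + 1) B := by rw [show (2 : WithTop ℕ∞) + 1 = 3 by norm_num]; exact hB3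
  have hB12 : ContDiff ℝ (1 + 2) B := by rw [show (1 : WithTop ℕ∞) + 2 = 3 by norm_num]; exact hB3
  have hB11 : ContDiff ℝ (1 + 1) B := by rw [show (1 : WithTop ℕ∞) + 1 = 2 by norm_num]; exact hB2
  -- the players
  set W : ι → E → ℝ := fun i y => ∑ j, ⟪curvature B y (b i) (b j), divCurvature B y (b j)⟫
    with hW
  set S : ι → ι → E → ℝ := fun i j y => ymStressEnergyOfBasis b B y i j with hS
  -- smoothness of the players
  have hF : ∀ i j, ContDiff ℝ 2 fun y => curvature B y (b i) (b j) := fun i j =>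
    contDiff_curvature_apply hB21 (b i) (b j)
  have hD : ∀ j, ContDiff ℝ 1 fun y => divCurvature B y (b j) := fun j =>
    contDiff_divCurvature_apply hB12 (b j)
  have hterm : ∀ i j, ContDiff ℝ 1 fun y => ⟪curvature B y (b i) (b j), divCurvature B y (b j)⟫ :=
    fun i j => ((hF i j).of_le (by norm_num)).inner ℝ (hD j)
  have hWs : ∀ i, ContDiff ℝ 1 (W i) := fun i => ContDiff.sum fun j _ => hterm i j
  have hSs : ∀ i j, ContDiff ℝ 1 (S i j) := fun i j => contDiff_ymStressEnergyOfBasis b hB11 i j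
  have hχ1 : ContDiff ℝ 1 χ := hχ.of_le (by norm_num)
  have hdχ : ∀ i, ContDiff ℝ 1 fun y => fderiv ℝ χ y (b i) := fun i =>
    (hχ.fderiv_right (m := 1) (by norm_num)).clm_apply contDiff_const
  have hdχc : ∀ i, HasCompactSupport fun y => fderiv ℝ χ y (b i) := fun i =>
    hχc.fderiv_apply (𝕜 := ℝ) (b i)
  -- Step 1: the divergence term is `∑ᵢ ∂ᵢ Wᵢ`
  have hdiv : ∀ y, ∑ i, ∑ j, fderiv ℝ (fun z => ⟪curvature B z (b i) (b j),
      divCurvature B z (b j)⟫) y (b i) = ∑ i, fderiv ℝ (W i) y (b i) := by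
    intro y
    refine Finset.sum_congr rfl fun i _ => ?_
    rw [hW, fderiv_fun_sum fun j _ => ((hterm i j).differentiable one_ne_zero) y,
      FunLike.coe_sum, Finset.sum_apply]
  -- Step 2: `Wᵢ = ∑_k ∂_k S_{ki}` (divergence identity (2.2))
  have hWS : ∀ i y, W i y = ∑ k, fderiv ℝ (S k i) y (b k) := fun i y =>
    sum_inner_curvature_divCurvature_eq_sum_fderiv_ymStressEnergyOfBasis b hB2 hval y i
  -- Step 3: first integration by parts
  have h1 : ∫ y, χ y * ∑ i, fderiv ℝ (W i) y (b i) = -∫ y, ∑ i, W i y * fderiv ℝ χ y (b i) :=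
    integral_mul_sum_fderiv_eq_neg_integral (fun i => b i) hχ1 hχc hWs
  -- Step 4: second integration by parts, direction by direction
  have h2 : ∀ i, ∫ y, (fderiv ℝ χ y (b i)) * ∑ k, fderiv ℝ (S k i) y (b k) =
      -∫ y, ∑ k, S k i y * fderiv ℝ (fun z => fderiv ℝ χ z (b i)) y (b k) := fun i =>
    integral_mul_sum_fderiv_eq_neg_integral (fun k => b k) (hdχ i) (hdχc i) fun k => hSs k i
  -- integrability of the summands in `i`
  have hint : ∀ i, Integrable fun y => W i y * fderiv ℝ χ y (b i) := fun i =>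
    ((hWs i).continuous.mul ((hχ1.continuous_fderiv one_ne_zero).clm_apply continuous_const))
      |>.integrable_of_hasCompactSupport (hdχc i).mul_left
  have hint2 : ∀ i, Integrable fun y => ∑ k, S k i y *
      fderiv ℝ (fun z => fderiv ℝ χ z (b i)) y (b k) := fun i => by
    refine integrable_finsetSum _ fun k _ => ?_
    exact ((hSs k i).continuous.mul (((hdχ i).continuous_fderiv one_ne_zero).clm_apply
      continuous_const)).integrable_of_hasCompactSupport ((hdχc i).fderiv_apply (𝕜 := ℝ) (b k)).mul_left
  -- assemble
  calc ∫ y, χ y * ∑ i, ∑ j, fderiv ℝ (fun z => ⟪curvature B z (b i) (b j),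
          divCurvature B z (b j)⟫) y (b i)
      = ∫ y, χ y * ∑ i, fderiv ℝ (W i) y (b i) := by simp_rw [hdiv]
    _ = -∫ y, ∑ i, W i y * fderiv ℝ χ y (b i) := h1
    _ = -∑ i, ∫ y, (fderiv ℝ χ y (b i)) * ∑ k, fderiv ℝ (S k i) y (b k) := by
        rw [integral_finsetSum _ fun i _ => hint i]
        congr 1
        refine Finset.sum_congr rfl fun i _ => integral_congr_ae (ae_of_all _ fun y => ?_)
        simp only [hWS i y, mul_comm]
    _ = ∑ i, ∫ y, ∑ k, S k i y * fderiv ℝ (fun z => fderiv ℝ χ z (b i)) y (b k) := by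
        rw [← Finset.sum_neg_distrib]
        exact Finset.sum_congr rfl fun i _ => by rw [h2 i, neg_neg]
    _ = ∫ y, ∑ i, ∑ k, S k i y * fderiv ℝ (fun z => fderiv ℝ χ z (b i)) y (b k) :=
        (integral_finsetSum _ fun i _ => hint2 i).symm
    _ = ∫ y, ∑ i, ∑ j, ymStressEnergyOfBasis b B y i j *
          fderiv ℝ (fun z => fderiv ℝ χ z (b j)) y (b i) := by
        refine integral_congr_ae (ae_of_all _ fun y => ?_)
        simp only [hS]
        rw [Finset.sum_comm]

end StressForm

/-! ### The weighted energy identity (2.5) -/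

section WeightedEnergy

open scoped Matrix.Norms.Frobenius

attribute [local instance] frobeniusInnerProductSpace

variable {m : Type*} [Fintype m] [DecidableEq m]
variable {E : Type*} [NormedAddCommGroup E] [InnerProductSpace ℝ E] [FiniteDimensional ℝ E]
  [MeasurableSpace E] [BorelSpace E]
variable {ι : Type*} [Fintype ι] [LinearOrder ι]

omit [FiniteDimensional ℝ E] [MeasurableSpace E] [BorelSpace E] in
/-- The stress–energy tensor of a jointly smooth time-dependent connection is jointly continuous
on the space-time slab. [folklore] -/
theorem continuousOn_ymStressEnergyOfBasis_joint (b : OrthonormalBasis ι ℝ E)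
    {A : ℝ → Connection E (Matrix m m ℂ)} {𝒯 : Set ℝ} (h𝒯 : IsOpen 𝒯)
    (hA : ContDiffOn ℝ ∞ (fun p : ℝ × E => A p.1 p.2) (𝒯 ×ˢ (univ : Set E))) (i j : ι) :
    ContinuousOn (fun p : ℝ × E => ymStressEnergyOfBasis b (A p.1) p.2 i j)
      (𝒯 ×ˢ (univ : Set E)) := by
  have hU : IsOpen (𝒯 ×ˢ (univ : Set E)) := h𝒯.prod isOpen_univ
  have hF : ∀ i j, ContinuousOn (fun p : ℝ × E => curvature (A p.1) p.2 (b i) (b j))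
      (𝒯 ×ˢ (univ : Set E)) := fun i j =>
    (contDiffOn_curvature_joint (m := 0) hU hA (by rw [zero_add]; exact ENat.LEInfty.out)
      (b i) (b j)).continuousOn
  have he : ContinuousOn (fun p : ℝ × E => ymDensityOfBasis b (A p.1) p.2)
      (𝒯 ×ˢ (univ : Set E)) :=
    (contDiffOn_ymDensityOfBasis_joint_on b h𝒯 hA ENat.LEInfty.out).continuousOn
  unfold ymStressEnergyOfBasis
  refine ContinuousOn.sub (continuousOn_finsetSum _ fun k _ => (hF i k).inner (hF j k)) ?_
  by_cases h : i = j
  · simp only [if_pos h]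
    exact he.div_const 2
  · simp only [if_neg h]
    exact continuousOn_const

omit [DecidableEq m] [Fintype m] in
/-- **Product integrability on `E × (t₁, t₂]` of a slab-continuous integrand vanishing off a
compact set** (the Fubini hypothesis for time integrals of spatial integrals). [folklore] -/
theorem integrable_prod_Ioc_of_continuousOn_of_eq_zero {𝒯 : Set ℝ} {g : ℝ × E → ℝ} {K : Set E}
    (hK : IsCompact K) (hg : ContinuousOn g (𝒯 ×ˢ (univ : Set E)))
    (hg0 : ∀ s, ∀ y ∉ K, g (s, y) = 0) {t₁ t₂ : ℝ} (hsub : Icc t₁ t₂ ⊆ 𝒯) :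
    Integrable (Function.uncurry fun (y : E) (s : ℝ) => g (s, y))
      ((volume : Measure E).prod (volume.restrict (Ioc t₁ t₂))) := by
  have hc : ContinuousOn (Function.uncurry fun (y : E) (s : ℝ) => g (s, y)) (K ×ˢ Icc t₁ t₂) := by
    refine hg.comp continuous_swap.continuousOn ?_
    rintro ⟨y, s⟩ ⟨_, hs⟩
    exact ⟨hsub hs, mem_univ y⟩
  have hi : IntegrableOn (Function.uncurry fun (y : E) (s : ℝ) => g (s, y))
      (K ×ˢ Ioc t₁ t₂) (volume.prod volume) := by
    rw [← Measure.volume_eq_prod]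
    exact (hc.integrableOn_compact (hK.prod isCompact_Icc)).mono_set
      (prod_mono Subset.rfl Ioc_subset_Icc_self)
  have hi' : IntegrableOn (Function.uncurry fun (y : E) (s : ℝ) => g (s, y))
      ((univ : Set E) ×ˢ Ioc t₁ t₂) (volume.prod volume) := by
    refine hi.of_forall_sdiff_eq_zero (MeasurableSet.univ.prod measurableSet_Ioc) ?_
    rintro ⟨y, s⟩ ⟨hmem, hys⟩
    have hy : y ∉ K := fun hyK => hys ⟨hyK, hmem.2⟩
    exact hg0 s y hy
  have hμ : (volume : Measure E).prod (volume.restrict (Ioc t₁ t₂)) =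
      ((volume : Measure E).prod volume).restrict ((univ : Set E) ×ˢ Ioc t₁ t₂) := by
    rw [← Measure.prod_restrict, Measure.restrict_univ]
  rw [hμ]
  exact hi'

omit [DecidableEq m] [Fintype m] in
/-- **Product integrability on `U × (t₁, t₂]`** of a slab-continuous integrand, for `U` contained
in a compact set (Fubini hypothesis for time integrals of integrals over balls and annuli).
[folklore] -/
theorem integrable_restrict_prod_Ioc_of_continuousOn {𝒯 : Set ℝ} {g : ℝ × E → ℝ} {K U : Set E}
    (hK : IsCompact K) (hUK : U ⊆ K)
    (hg : ContinuousOn g (𝒯 ×ˢ (univ : Set E))) {t₁ t₂ : ℝ} (hsub : Icc t₁ t₂ ⊆ 𝒯) :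
    Integrable (Function.uncurry fun (y : E) (s : ℝ) => g (s, y))
      ((volume.restrict U).prod (volume.restrict (Ioc t₁ t₂))) := by
  have hc : ContinuousOn (Function.uncurry fun (y : E) (s : ℝ) => g (s, y)) (K ×ˢ Icc t₁ t₂) := by
    refine hg.comp continuous_swap.continuousOn ?_
    rintro ⟨y, s⟩ ⟨_, hs⟩
    exact ⟨hsub hs, mem_univ y⟩
  have hi : IntegrableOn (Function.uncurry fun (y : E) (s : ℝ) => g (s, y))
      (U ×ˢ Ioc t₁ t₂) (volume.prod volume) := by
    rw [← Measure.volume_eq_prod]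
    exact (hc.integrableOn_compact (hK.prod isCompact_Icc)).mono_set
      (prod_mono hUK Ioc_subset_Icc_self)
  rw [Measure.prod_restrict]
  exact hi

/-- Time integrals of spatial integrals of slab-continuous, compactly supported integrands
exist. [folklore] -/
theorem intervalIntegrable_integral_of_continuousOn {𝒯 : Set ℝ} {g : ℝ × E → ℝ} {K : Set E}
    (hK : IsCompact K) (hg : ContinuousOn g (𝒯 ×ˢ (univ : Set E)))
    (hg0 : ∀ s, ∀ y ∉ K, g (s, y) = 0) {t₁ t₂ : ℝ} (h12 : t₁ ≤ t₂) (hsub : Icc t₁ t₂ ⊆ 𝒯) :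
    IntervalIntegrable (fun s => ∫ y, g (s, y)) volume t₁ t₂ := by
  rw [intervalIntegrable_iff_integrableOn_Ioc_of_le h12]
  exact (integrable_prod_Ioc_of_continuousOn_of_eq_zero hK hg hg0 hsub).integral_prod_right

/-- Time integrals of integrals over bounded sets of slab-continuous integrands exist.
[folklore] -/
theorem intervalIntegrable_setIntegral_of_continuousOn {𝒯 : Set ℝ} {g : ℝ × E → ℝ} {K U : Set E}
    (hK : IsCompact K) (hUK : U ⊆ K)
    (hg : ContinuousOn g (𝒯 ×ˢ (univ : Set E))) {t₁ t₂ : ℝ} (h12 : t₁ ≤ t₂)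
    (hsub : Icc t₁ t₂ ⊆ 𝒯) :
    IntervalIntegrable (fun s => ∫ y in U, g (s, y)) volume t₁ t₂ := by
  rw [intervalIntegrable_iff_integrableOn_Ioc_of_le h12]
  exact (integrable_restrict_prod_Ioc_of_continuousOn hK hUK hg hsub).integral_prod_right

/-- **Waldron's weighted energy identity (2.5), integrated in time.** Let `A` be jointly smooth
on `𝒯 × E` (`𝒯` open), `𝔲(m)`-valued, and solve the Yang–Mills heat equation
`∂ₜ A = div_A F_A = −D^*F` on `𝒯`; let `χ` be a `C²` compactly supported weight and
`[t₁, t₂] ⊆ 𝒯`. Then, with `e = ∑_{i<j} ‖F_{ij}‖²` and the stress–energy tensor `S_{ij}`,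
`∫ χ e(t₂) − ∫ χ e(t₁) = −2 ∫_{t₁}^{t₂} ∫ χ ∑ⱼ ‖(div F)_j‖² + 2 ∫_{t₁}^{t₂} ∫ ∑ᵢⱼ S_{ij} ∂ᵢ∂ⱼχ`,
i.e. `½ d/dt ∫ |F|² χ + ∫ |D^*F|² χ = ∫ S_{ij} ∇ⁱ∇ʲ χ`. Proof as printed: the pointwise identity
(2.4) (`hasDerivAt_ymDensityOfBasis_of_flow_on`), two integrations by parts
(`integral_mul_divergenceTerm_eq_integral_stress`), the fundamental theorem of calculus in `t`
and Fubini on `supp χ × [t₁, t₂]`. [cite: Waldron2019, §2 (2.5)] -/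
theorem weightedEnergy_sub_eq_of_flow_on (b : OrthonormalBasis ι ℝ E)
    {A : ℝ → Connection E (Matrix m m ℂ)} {𝒯 : Set ℝ} (h𝒯 : IsOpen 𝒯)
    (hA : ContDiffOn ℝ ∞ (fun p : ℝ × E => A p.1 p.2) (𝒯 ×ˢ (univ : Set E)))
    (hval : ∀ ⦃s : ℝ⦄, s ∈ 𝒯 → (A s).IsValuedIn (skewAdjoint.submodule ℝ (Matrix m m ℂ)))
    (hpde : ∀ ⦃s : ℝ⦄, s ∈ 𝒯 → ∀ y w, deriv (fun s' => A s' y w) s = divCurvature (A s) y w)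
    {χ : E → ℝ} (hχ : ContDiff ℝ 2 χ) (hχc : HasCompactSupport χ)
    {t₁ t₂ : ℝ} (h12 : t₁ ≤ t₂) (hsub : Icc t₁ t₂ ⊆ 𝒯) :
    (∫ y, χ y * ymDensityOfBasis b (A t₂) y) - (∫ y, χ y * ymDensityOfBasis b (A t₁) y) =
      -2 * (∫ s in t₁..t₂, ∫ y, χ y * ∑ j, ‖divCurvature (A s) y (b j)‖ ^ 2) +
        2 * ∫ s in t₁..t₂, ∫ y, ∑ i, ∑ j, ymStressEnergyOfBasis b (A s) y i j *
          fderiv ℝ (fun z => fderiv ℝ χ z (b j)) y (b i) := by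
  set U : Set (ℝ × E) := 𝒯 ×ˢ univ with hU'
  have hU : IsOpen U := h𝒯.prod isOpen_univ
  have h2 : (2 : WithTop ℕ∞) ≤ ∞ := ENat.LEInfty.out
  set K : Set E := tsupport χ with hK
  have hKc : IsCompact K := hχc
  -- the densities on space-time
  set e : ℝ × E → ℝ := fun p => ymDensityOfBasis b (A p.1) p.2 with he
  set Pt : ℝ × E → ℝ := fun p => ∑ i, ∑ j,
    fderiv ℝ (fun y => ⟪curvature (A p.1) y (b i) (b j),
      fderiv ℝ (fun q : ℝ × E => A q.1 q.2) (p.1, y) ((1 : ℝ), (0 : E)) (b j)⟫) p.2 (b i) with hPt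
  set Dis : ℝ × E → ℝ := fun p => ∑ j, ‖divCurvature (A p.1) p.2 (b j)‖ ^ 2 with hDis
  set rate : ℝ × E → ℝ := fun p => 2 * Pt p - 2 * Dis p with hrate
  set St : ℝ × E → ℝ := fun p => ∑ i, ∑ j, ymStressEnergyOfBasis b (A p.1) p.2 i j *
    fderiv ℝ (fun z => fderiv ℝ χ z (b j)) p.2 (b i) with hSt
  -- continuity on the slab
  have hrate_c : ContinuousOn rate U := continuousOn_energyRate_of_flow_on b h𝒯 hA h2 hval hpde
  have hPt_c : ContinuousOn Pt U := continuousOn_divergenceTerm_of_flow_on b h𝒯 hA h2 hval hpde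
  have hDis_c : ContinuousOn Dis U := by
    refine ((hPt_c.sub ((continuousOn_const (c := (2⁻¹ : ℝ))).mul hrate_c))).congr ?_
    intro p _
    simp only [hrate, Pi.sub_apply, Pi.mul_apply]
    ring
  have he_c : ContinuousOn e U := (contDiffOn_ymDensityOfBasis_joint_on b h𝒯 hA h2).continuousOn
  have hχ_c : Continuous χ := hχ.continuous
  have hd2χ_c : ∀ i j, Continuous fun y => fderiv ℝ (fun z => fderiv ℝ χ z (b j)) y (b i) := by
    intro i j
    have h1 : ContDiff ℝ 1 fun z => fderiv ℝ χ z (b j) :=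
      (hχ.fderiv_right (m := 1) (by norm_num)).clm_apply contDiff_const
    exact (h1.continuous_fderiv one_ne_zero).clm_apply continuous_const
  have hSt_c : ContinuousOn St U := by
    refine continuousOn_finsetSum _ fun i _ => continuousOn_finsetSum _ fun j _ => ?_
    exact (continuousOn_ymStressEnergyOfBasis_joint b h𝒯 hA i j).mul
      ((hd2χ_c i j).comp continuous_snd).continuousOn
  -- the time derivative of `e`
  have hderiv : ∀ p ∈ U, HasDerivAt (fun s => e (s, p.2)) (rate p) p.1 := by
    rintro ⟨s, y⟩ hp
    exact hasDerivAt_ymDensityOfBasis_of_flow_on b h𝒯 hA h2 hp.1 y (hval hp.1 y) (hpde hp.1 y)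
  -- slices
  have hslice_y : ∀ {f : ℝ × E → ℝ}, ContinuousOn f U → ∀ {s : ℝ}, s ∈ 𝒯 →
      Continuous fun y => f (s, y) := fun hf s hs =>
    continuousOn_univ.mp (hf.comp (continuous_const.prodMk continuous_id).continuousOn
      fun y _ => ⟨hs, mem_univ y⟩)
  have hslice_s : ∀ {f : ℝ × E → ℝ}, ContinuousOn f U → ∀ y,
      ContinuousOn (fun s => f (s, y)) (Icc t₁ t₂) := fun hf y =>
    hf.comp (continuous_id.prodMk continuous_const).continuousOn
      fun s hs => ⟨hsub hs, mem_univ y⟩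
  -- vanishing off the support of `χ`
  have hχ0 : ∀ y ∉ K, χ y = 0 := fun y hy => image_eq_zero_of_notMem_tsupport hy
  have hSt0 : ∀ s, ∀ y ∉ K, St (s, y) = 0 := by
    intro s y hy
    simp only [hSt]
    refine Finset.sum_eq_zero fun i _ => Finset.sum_eq_zero fun j _ => ?_
    rw [fderiv_fderiv_apply_eq_zero_of_notMem_tsupport hy, mul_zero]
  -- Step 1: fundamental theorem of calculus in time, pointwise in `y`
  have hFTC : ∀ y, ∫ s in t₁..t₂, rate (s, y) = e (t₂, y) - e (t₁, y) := by
    intro y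
    refine intervalIntegral.integral_eq_sub_of_hasDerivAt (f := fun s => e (s, y))
      (f' := fun s => rate (s, y)) (fun s hs => ?_)
      ((hslice_s hrate_c y).intervalIntegrable_of_Icc h12)
    rw [uIcc_of_le h12] at hs
    exact hderiv (s, y) ⟨hsub hs, mem_univ y⟩
  -- Step 2: integrate against `χ`
  have hint_e : ∀ {s : ℝ}, s ∈ 𝒯 → Integrable (fun y => χ y * e (s, y)) := fun hs =>
    (hχ_c.mul (hslice_y he_c hs)).integrable_of_hasCompactSupport hχc.mul_right
  have hLHS : (∫ y, χ y * e (t₂, y)) - ∫ y, χ y * e (t₁, y) =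
      ∫ y, ∫ s in t₁..t₂, χ y * rate (s, y) := by
    rw [← integral_sub (hint_e (hsub ⟨h12, le_rfl⟩)) (hint_e (hsub ⟨le_rfl, h12⟩))]
    refine integral_congr_ae (ae_of_all _ fun y => ?_)
    show χ y * e (t₂, y) - χ y * e (t₁, y) = ∫ s in t₁..t₂, χ y * rate (s, y)
    rw [intervalIntegral.integral_const_mul, hFTC y]
    ring
  -- Step 3: Fubini on `E × [t₁, t₂]` (the integrands vanish off `K × [t₁, t₂]`)
  have hprodInt : ∀ {g : ℝ × E → ℝ}, ContinuousOn g U → (∀ s, ∀ y ∉ K, g (s, y) = 0) →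
      Integrable (Function.uncurry fun (y : E) (s : ℝ) => g (s, y))
        ((volume : Measure E).prod (volume.restrict (Ioc t₁ t₂))) := fun hg hg0 =>
    integrable_prod_Ioc_of_continuousOn_of_eq_zero hKc hg hg0 hsub
  have hχrate_c : ContinuousOn (fun p : ℝ × E => χ p.2 * rate p) U :=
    (hχ_c.comp_continuousOn continuousOn_snd).mul hrate_c
  have hχDis_c : ContinuousOn (fun p : ℝ × E => χ p.2 * Dis p) U :=
    (hχ_c.comp_continuousOn continuousOn_snd).mul hDis_c
  have hswap : ∫ y, ∫ s in t₁..t₂, χ y * rate (s, y) = ∫ s in t₁..t₂, ∫ y, χ y * rate (s, y) := by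
    simp_rw [intervalIntegral.integral_of_le h12]
    exact integral_integral_swap (hprodInt (g := fun p => χ p.2 * rate p) hχrate_c
      (fun s y hy => by simp only [hχ0 y hy, zero_mul]))
  -- Step 4: the identity at each fixed time
  have hinner : ∀ s ∈ Ioc t₁ t₂, ∫ y, χ y * rate (s, y) =
      2 * (∫ y, St (s, y)) - 2 * ∫ y, χ y * Dis (s, y) := by
    intro s hs
    have hs0 : s ∈ 𝒯 := hsub ⟨hs.1.le, hs.2⟩
    have hsm : ContDiff ℝ ∞ (A s) := contDiff_slice_of_contDiffOn_prod hA hs0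
    -- replace `Ȧ` by `div F` in the divergence term
    have hAdot : ∀ y w, fderiv ℝ (fun q : ℝ × E => A q.1 q.2) (s, y) ((1 : ℝ), (0 : E)) w =
        divCurvature (A s) y w := fun y w =>
      (norm_divCurvature_eq_of_flow_on h𝒯 hA (by simp) hs0 y w (hpde hs0 y w)).symm
    have hPt_eq : ∀ y, Pt (s, y) = ∑ i, ∑ j, fderiv ℝ (fun z => ⟪curvature (A s) z (b i) (b j),
        divCurvature (A s) z (b j)⟫) y (b i) := by
      intro y
      simp only [hPt]
      refine Finset.sum_congr rfl fun i _ => Finset.sum_congr rfl fun j _ => ?_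
      have hfun : (fun z => ⟪curvature (A s) z (b i) (b j),
          fderiv ℝ (fun q : ℝ × E => A q.1 q.2) (s, z) ((1 : ℝ), (0 : E)) (b j)⟫) =
          fun z => ⟪curvature (A s) z (b i) (b j), divCurvature (A s) z (b j)⟫ := by
        funext z
        rw [hAdot z (b j)]
      rw [hfun]
    have hdivInt : ∫ y, χ y * Pt (s, y) = ∫ y, St (s, y) := by
      simp_rw [hPt_eq]
      exact integral_mul_divergenceTerm_eq_integral_stress b hsm (hval hs0) hχ hχc
    have hiP : Integrable (fun y => χ y * Pt (s, y)) :=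
      (hχ_c.mul (hslice_y hPt_c hs0)).integrable_of_hasCompactSupport hχc.mul_right
    have hiD : Integrable (fun y => χ y * Dis (s, y)) :=
      (hχ_c.mul (hslice_y hDis_c hs0)).integrable_of_hasCompactSupport hχc.mul_right
    calc ∫ y, χ y * rate (s, y) = ∫ y, (2 * (χ y * Pt (s, y)) - 2 * (χ y * Dis (s, y))) := by
          refine integral_congr_ae (ae_of_all _ fun y => ?_)
          simp only [hrate]
          ring
      _ = 2 * (∫ y, χ y * Pt (s, y)) - 2 * ∫ y, χ y * Dis (s, y) := by
          rw [integral_sub (hiP.const_mul 2) (hiD.const_mul 2), integral_const_mul,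
            integral_const_mul]
      _ = 2 * (∫ y, St (s, y)) - 2 * ∫ y, χ y * Dis (s, y) := by rw [hdivInt]
  -- integrability in time of the two spatial integrals (Fubini)
  have hSt_t : IntervalIntegrable (fun s => ∫ y, St (s, y)) volume t₁ t₂ := by
    rw [intervalIntegrable_iff_integrableOn_Ioc_of_le h12]
    exact (hprodInt hSt_c hSt0).integral_prod_right
  have hDis_t : IntervalIntegrable (fun s => ∫ y, χ y * Dis (s, y)) volume t₁ t₂ := by
    rw [intervalIntegrable_iff_integrableOn_Ioc_of_le h12]
    exact (hprodInt (g := fun p => χ p.2 * Dis p) hχDis_c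
      (fun s y hy => by simp only [hχ0 y hy, zero_mul])).integral_prod_right
  have hRHS : ∫ s in t₁..t₂, ∫ y, χ y * rate (s, y) =
      2 * (∫ s in t₁..t₂, ∫ y, St (s, y)) - 2 * ∫ s in t₁..t₂, ∫ y, χ y * Dis (s, y) := by
    rw [← intervalIntegral.integral_const_mul, ← intervalIntegral.integral_const_mul,
      ← intervalIntegral.integral_sub (hSt_t.const_mul 2) (hDis_t.const_mul 2),
      intervalIntegral.integral_of_le h12, intervalIntegral.integral_of_le h12]
    exact setIntegral_congr_fun measurableSet_Ioc hinner
  -- assemble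
  rw [hLHS, hswap, hRHS]
  ring

end WeightedEnergy

/-! ### The `r²`-weighted identity (2.9) -/

section RSqWeighted

variable {E : Type*} [NormedAddCommGroup E] [InnerProductSpace ℝ E]

/-- `z ↦ ½‖z − x₀‖²` has derivative `v ↦ ⟨z − x₀, v⟩`. [folklore] -/
theorem hasFDerivAt_half_norm_sq_sub (x₀ y : E) :
    HasFDerivAt (fun z : E => 2⁻¹ * ‖z - x₀‖ ^ 2) (innerSL ℝ (y - x₀)) y := by
  have h := (((hasFDerivAt_id y).sub_const x₀).norm_sq).const_mul (2⁻¹ : ℝ)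
  refine h.congr_fderiv ?_
  ext v
  simp only [smul_apply, ContinuousLinearMap.comp_apply,
    ContinuousLinearMap.id_apply, innerSL_apply_apply, smul_eq_mul, id_eq]
  ring

/-- `z ↦ ⟨z − x₀, v⟩` has derivative `u ↦ ⟨u, v⟩` (`= innerSL v` over `ℝ`). [folklore] -/
theorem hasFDerivAt_inner_sub_const (x₀ v y : E) :
    HasFDerivAt (fun z : E => ⟪z - x₀, v⟫) (innerSL ℝ v) y := by
  have h := ((hasFDerivAt_id y).sub_const x₀).inner ℝ (hasFDerivAt_const v y)
  refine h.congr_fderiv ?_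
  ext u
  simp [fderivInnerCLM_apply, real_inner_comm]

variable {ι : Type*} [Fintype ι]

/-- **Second derivatives of the weight `½ r² φ`.** For `φ ∈ C²` and an orthonormal frame `b`,
with `X_i = ⟨y − x₀, bᵢ⟩` and `η = ½‖y − x₀‖²`:
`∂ᵢ∂ⱼ(η φ) = δ_{ij} φ + X_j ∂ᵢφ + X_i ∂ⱼφ + η ∂ᵢ∂ⱼφ` (Waldron 2019, display before (2.8), flat
case `h^{ij} = 0`). [cite: Waldron2019, §2 (2.8)] -/
theorem fderiv_fderiv_halfNormSq_mul [DecidableEq ι] (b : OrthonormalBasis ι ℝ E) {φ : E → ℝ}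
    (hφ : ContDiff ℝ 2 φ) (x₀ y : E) (i j : ι) :
    fderiv ℝ (fun z => fderiv ℝ (fun w => 2⁻¹ * ‖w - x₀‖ ^ 2 * φ w) z (b j)) y (b i) =
      (if i = j then φ y else 0) + ⟪y - x₀, b j⟫ * fderiv ℝ φ y (b i) +
        ⟪y - x₀, b i⟫ * fderiv ℝ φ y (b j) +
        2⁻¹ * ‖y - x₀‖ ^ 2 * fderiv ℝ (fun z => fderiv ℝ φ z (b j)) y (b i) := by
  set η : E → ℝ := fun w => 2⁻¹ * ‖w - x₀‖ ^ 2 with hη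
  have hηd : ∀ z, HasFDerivAt η (innerSL ℝ (z - x₀)) z := hasFDerivAt_half_norm_sq_sub x₀
  have hφd : Differentiable ℝ φ := hφ.differentiable two_ne_zero
  have hdφ : ∀ v, Differentiable ℝ fun z => fderiv ℝ φ z v := fun v =>
    ((hφ.fderiv_right (m := 1) (by norm_num)).differentiable one_ne_zero).clm_apply
      (differentiable_const v)
  have hX : ∀ z, HasFDerivAt (fun w : E => ⟪w - x₀, b j⟫) (innerSL ℝ (b j)) z :=
    hasFDerivAt_inner_sub_const x₀ (b j)
  -- first derivative as a function of the base point
  have h1 : (fun z => fderiv ℝ (fun w => η w * φ w) z (b j)) =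
      fun z => ⟪z - x₀, b j⟫ * φ z + η z * fderiv ℝ φ z (b j) := by
    funext z
    rw [fderiv_fun_mul (hηd z).differentiableAt (hφd z), add_apply, smul_apply, smul_apply,
      (hηd z).fderiv, innerSL_apply_apply, smul_eq_mul, smul_eq_mul]
    ring
  change fderiv ℝ (fun z => fderiv ℝ (fun w => η w * φ w) z (b j)) y (b i) = _
  rw [h1, fderiv_fun_add (((hX y).differentiableAt).fun_mul (hφd y))
    (((hηd y).differentiableAt).fun_mul (hdφ (b j) y)),
    fderiv_fun_mul (hX y).differentiableAt (hφd y),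
    fderiv_fun_mul (hηd y).differentiableAt (hdφ (b j) y)]
  simp only [add_apply, smul_apply, (hX y).fderiv, (hηd y).fderiv, innerSL_apply_apply, smul_eq_mul,
    b.inner_eq_ite]
  by_cases h : i = j
  · subst h
    simp only [if_true]
    ring
  · rw [if_neg h, if_neg (Ne.symm h)]
    ring

/-- **Contraction with a symmetric trace-free tensor.** If `S` is symmetric with `∑ᵢ S_{ii} = 0`
then `∑ᵢⱼ S_{ij} ∂ᵢ∂ⱼ(½r²φ) = ∑ᵢⱼ S_{ij} (2 X_i ∂ⱼφ + ½ r² ∂ᵢ∂ⱼφ)` (Waldron 2019, (2.8) in the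
flat case: the `g^{ij}`-terms drop out by tracelessness). [cite: Waldron2019, §2 (2.8)] -/
theorem sum_sum_mul_fderiv_fderiv_halfNormSq_mul [DecidableEq ι] (b : OrthonormalBasis ι ℝ E)
    {φ : E → ℝ} (hφ : ContDiff ℝ 2 φ) (x₀ y : E) {S : ι → ι → ℝ}
    (hsymm : ∀ i j, S i j = S j i) (htr : ∑ i, S i i = 0) :
    ∑ i, ∑ j, S i j * fderiv ℝ (fun z => fderiv ℝ (fun w => 2⁻¹ * ‖w - x₀‖ ^ 2 * φ w) z (b j))
        y (b i) =
      ∑ i, ∑ j, S i j * (2 * ⟪y - x₀, b i⟫ * fderiv ℝ φ y (b j) +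
        2⁻¹ * ‖y - x₀‖ ^ 2 * fderiv ℝ (fun z => fderiv ℝ φ z (b j)) y (b i)) := by
  simp_rw [fderiv_fderiv_halfNormSq_mul b hφ x₀ y]
  -- the `δ_{ij}` term vanishes by tracelessness
  have hδ : ∑ i, ∑ j, S i j * (if i = j then φ y else 0) = 0 := by
    simp only [mul_ite, mul_zero, Finset.sum_ite_eq, Finset.mem_univ, if_true, ← Finset.sum_mul,
      htr, zero_mul]
  -- the two cross terms agree by symmetry
  have hcross : ∑ i, ∑ j, S i j * (⟪y - x₀, b j⟫ * fderiv ℝ φ y (b i)) =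
      ∑ i, ∑ j, S i j * (⟪y - x₀, b i⟫ * fderiv ℝ φ y (b j)) := by
    rw [Finset.sum_comm]
    exact Finset.sum_congr rfl fun i _ => Finset.sum_congr rfl fun j _ => by rw [hsymm j i]
  have hsplit : ∑ i, ∑ j, S i j * ((if i = j then φ y else 0) + ⟪y - x₀, b j⟫ * fderiv ℝ φ y (b i) +
      ⟪y - x₀, b i⟫ * fderiv ℝ φ y (b j) +
      2⁻¹ * ‖y - x₀‖ ^ 2 * fderiv ℝ (fun z => fderiv ℝ φ z (b j)) y (b i)) =
      ∑ i, ∑ j, S i j * (if i = j then φ y else 0) +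
      ∑ i, ∑ j, S i j * (⟪y - x₀, b j⟫ * fderiv ℝ φ y (b i)) +
      ∑ i, ∑ j, S i j * (⟪y - x₀, b i⟫ * fderiv ℝ φ y (b j)) +
      ∑ i, ∑ j, S i j * (2⁻¹ * ‖y - x₀‖ ^ 2 * fderiv ℝ (fun z => fderiv ℝ φ z (b j)) y (b i)) := by
    simp only [← Finset.sum_add_distrib]
    exact Finset.sum_congr rfl fun i _ => Finset.sum_congr rfl fun j _ => by ring
  rw [hsplit, hδ, hcross, zero_add]
  simp only [← Finset.sum_add_distrib]
  exact Finset.sum_congr rfl fun i _ => Finset.sum_congr rfl fun j _ => by ring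

end RSqWeighted

section MainIdentity

open scoped Matrix.Norms.Frobenius

attribute [local instance] frobeniusInnerProductSpace

variable {m : Type*} [Fintype m] [DecidableEq m]
variable {E : Type*} [NormedAddCommGroup E] [InnerProductSpace ℝ E] [FiniteDimensional ℝ E]
  [MeasurableSpace E] [BorelSpace E]
variable {ι : Type*} [Fintype ι] [LinearOrder ι]

/-- **Waldron's localized and weighted energy identity (2.9)** ("mainenidentity") in the flat
setting. Let `A` be a jointly smooth `𝔲(m)`-valued solution of the Yang–Mills heat equation on
the open time set `𝒯` over a four-dimensional `E`, `φ ∈ C²_c(E)` a weight, `x₀ ∈ E`,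
`r = ‖y − x₀‖`, `X_i = ⟨y − x₀, bᵢ⟩`, and `[τ₁, τ₂] ⊆ 𝒯`. Then
`∫ |F(τ₂)|² φ r² + 2 ∫_{τ₁}^{τ₂}∫ |D^*F|² φ r² = ∫ |F(τ₁)|² φ r² + S(φ, τ₁, τ₂)` with
`S(φ, τ₁, τ₂) = 4 ∫_{τ₁}^{τ₂}∫ ∑ᵢⱼ S_{ij} (2 X_i ∂ⱼφ + ½ r² ∂ᵢ∂ⱼφ)`
(for a radial cut-off `φ = φ_λ` this is Waldron's `S(λ, τ₁, τ₂) = 2∫∫ XⁱXʲ S_{ij} Δφ_λ`, (2.6);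
here `|F|² = ∑_{i<j}‖F_{ij}‖²`, `|D^*F|² = ∑ⱼ ‖(div F)_j‖²`). Proof as printed: (2.5) with
`χ = ½ r² φ`, `∇ⁱ∇ʲχ = g^{ij}φ + Xⁱ∇ʲφ + Xʲ∇ⁱφ + ½r²∇ⁱ∇ʲφ` and tracelessness of `S` in dimension
four. [cite: Waldron2019, §2 (2.9)] -/
theorem weightedEnergy_rsq_identity_of_flow_on (b : OrthonormalBasis ι ℝ E)
    (hι : Fintype.card ι = 4)
    {A : ℝ → Connection E (Matrix m m ℂ)} {𝒯 : Set ℝ} (h𝒯 : IsOpen 𝒯)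
    (hA : ContDiffOn ℝ ∞ (fun p : ℝ × E => A p.1 p.2) (𝒯 ×ˢ (univ : Set E)))
    (hval : ∀ ⦃s : ℝ⦄, s ∈ 𝒯 → (A s).IsValuedIn (skewAdjoint.submodule ℝ (Matrix m m ℂ)))
    (hpde : ∀ ⦃s : ℝ⦄, s ∈ 𝒯 → ∀ y w, deriv (fun s' => A s' y w) s = divCurvature (A s) y w)
    {φ : E → ℝ} (hφ : ContDiff ℝ 2 φ) (hφc : HasCompactSupport φ) (x₀ : E)
    {τ₁ τ₂ : ℝ} (h12 : τ₁ ≤ τ₂) (hsub : Icc τ₁ τ₂ ⊆ 𝒯) :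
    (∫ y, φ y * ‖y - x₀‖ ^ 2 * ymDensityOfBasis b (A τ₂) y) +
      2 * (∫ s in τ₁..τ₂, ∫ y, φ y * ‖y - x₀‖ ^ 2 * ∑ j, ‖divCurvature (A s) y (b j)‖ ^ 2) =
    (∫ y, φ y * ‖y - x₀‖ ^ 2 * ymDensityOfBasis b (A τ₁) y) +
      4 * ∫ s in τ₁..τ₂, ∫ y, ∑ i, ∑ j, ymStressEnergyOfBasis b (A s) y i j *
        (2 * ⟪y - x₀, b i⟫ * fderiv ℝ φ y (b j) +
          2⁻¹ * ‖y - x₀‖ ^ 2 * fderiv ℝ (fun z => fderiv ℝ φ z (b j)) y (b i)) := by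
  -- the weight `χ = ½ r² φ`
  set χ : E → ℝ := fun w => 2⁻¹ * ‖w - x₀‖ ^ 2 * φ w with hχdef
  have hη : ContDiff ℝ 2 fun w : E => 2⁻¹ * ‖w - x₀‖ ^ 2 :=
    contDiff_const.mul ((contDiff_norm_sq ℝ).comp (contDiff_id.sub contDiff_const))
  have hχ : ContDiff ℝ 2 χ := hη.mul hφ
  have hχc : HasCompactSupport χ := hφc.mul_left
  have h25 := weightedEnergy_sub_eq_of_flow_on b h𝒯 hA hval hpde hχ hχc h12 hsub
  -- rewrite the three kinds of integrands
  have hL : ∀ s, ∫ y, χ y * ymDensityOfBasis b (A s) y =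
      2⁻¹ * ∫ y, φ y * ‖y - x₀‖ ^ 2 * ymDensityOfBasis b (A s) y := by
    intro s
    rw [← integral_const_mul]
    refine integral_congr_ae (ae_of_all _ fun y => ?_)
    simp only [hχdef]
    ring
  have hD : ∀ s, ∫ y, χ y * ∑ j, ‖divCurvature (A s) y (b j)‖ ^ 2 =
      2⁻¹ * ∫ y, φ y * ‖y - x₀‖ ^ 2 * ∑ j, ‖divCurvature (A s) y (b j)‖ ^ 2 := by
    intro s
    rw [← integral_const_mul]
    refine integral_congr_ae (ae_of_all _ fun y => ?_)
    simp only [hχdef]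
    ring
  have hS : ∀ s ∈ Ioc τ₁ τ₂, ∫ y, ∑ i, ∑ j, ymStressEnergyOfBasis b (A s) y i j *
      fderiv ℝ (fun z => fderiv ℝ χ z (b j)) y (b i) =
      ∫ y, ∑ i, ∑ j, ymStressEnergyOfBasis b (A s) y i j *
        (2 * ⟪y - x₀, b i⟫ * fderiv ℝ φ y (b j) +
          2⁻¹ * ‖y - x₀‖ ^ 2 * fderiv ℝ (fun z => fderiv ℝ φ z (b j)) y (b i)) := by
    intro s _
    refine integral_congr_ae (ae_of_all _ fun y => ?_)
    exact sum_sum_mul_fderiv_fderiv_halfNormSq_mul b hφ x₀ y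
      (fun i j => ymStressEnergyOfBasis_symm b (A s) y i j)
      (sum_ymStressEnergyOfBasis_diag_eq_zero b (A s) y hι)
  have hDint : ∫ s in τ₁..τ₂, ∫ y, χ y * ∑ j, ‖divCurvature (A s) y (b j)‖ ^ 2 =
      2⁻¹ * ∫ s in τ₁..τ₂, ∫ y, φ y * ‖y - x₀‖ ^ 2 * ∑ j, ‖divCurvature (A s) y (b j)‖ ^ 2 := by
    rw [← intervalIntegral.integral_const_mul]
    exact intervalIntegral.integral_congr fun s _ => hD s
  have hSint : ∫ s in τ₁..τ₂, ∫ y, ∑ i, ∑ j, ymStressEnergyOfBasis b (A s) y i j *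
      fderiv ℝ (fun z => fderiv ℝ χ z (b j)) y (b i) =
      ∫ s in τ₁..τ₂, ∫ y, ∑ i, ∑ j, ymStressEnergyOfBasis b (A s) y i j *
        (2 * ⟪y - x₀, b i⟫ * fderiv ℝ φ y (b j) +
          2⁻¹ * ‖y - x₀‖ ^ 2 * fderiv ℝ (fun z => fderiv ℝ φ z (b j)) y (b i)) := by
    rw [intervalIntegral.integral_of_le h12, intervalIntegral.integral_of_le h12]
    exact setIntegral_congr_fun measurableSet_Ioc hS
  rw [hL τ₂, hL τ₁, hDint, hSint] at h25
  linarith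

end MainIdentity

/-! ### The obvious bound (2.7) on the stress weight -/

section ObviousBound

variable {E : Type*} [NormedAddCommGroup E] [InnerProductSpace ℝ E]

/-- Second directional derivatives as values of the second iterated derivative:
`∂_u (∂_v φ)(y) = D²φ(y)(u, v)` for `φ ∈ C²`. [folklore] -/
theorem fderiv_fderiv_apply_eq_iteratedFDeriv_two {φ : E → ℝ} (hφ : ContDiff ℝ 2 φ) (y u v : E) :
    fderiv ℝ (fun z => fderiv ℝ φ z v) y u = iteratedFDeriv ℝ 2 φ y ![u, v] := by
  have hd : DifferentiableAt ℝ (fderiv ℝ φ) y :=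
    ((hφ.fderiv_right (m := 1) (by norm_num)).differentiable one_ne_zero) y
  rw [iteratedFDeriv_two_apply, (hasFDerivAt_clm_apply_const hd.hasFDerivAt v).fderiv]
  rfl

/-- First directional derivatives are bounded by the first iterated derivative:
`|∂_v φ(y)| ≤ ‖Dφ(y)‖ ‖v‖`. [folklore] -/
theorem abs_fderiv_apply_le_norm_iteratedFDeriv_one (φ : E → ℝ) (y v : E) :
    |fderiv ℝ φ y v| ≤ ‖iteratedFDeriv ℝ 1 φ y‖ * ‖v‖ := by
  rw [norm_iteratedFDeriv_one, ← Real.norm_eq_abs]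
  exact (fderiv ℝ φ y).le_opNorm v

/-- Second directional derivatives are bounded by the second iterated derivative:
`|∂_u∂_v φ(y)| ≤ ‖D²φ(y)‖ ‖u‖ ‖v‖` for `φ ∈ C²`. [folklore] -/
theorem abs_fderiv_fderiv_apply_le_norm_iteratedFDeriv_two {φ : E → ℝ} (hφ : ContDiff ℝ 2 φ)
    (y u v : E) :
    |fderiv ℝ (fun z => fderiv ℝ φ z v) y u| ≤ ‖iteratedFDeriv ℝ 2 φ y‖ * ‖u‖ * ‖v‖ := by
  rw [fderiv_fderiv_apply_eq_iteratedFDeriv_two hφ, ← Real.norm_eq_abs]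
  refine ((iteratedFDeriv ℝ 2 φ y).le_opNorm ![u, v]).trans_eq ?_
  rw [Fin.prod_univ_two, Matrix.cons_val_zero, Matrix.cons_val_one, Matrix.cons_val_fin_one,
    mul_assoc]

end ObviousBound

section ObviousBoundFlow

open scoped Matrix.Norms.Frobenius

attribute [local instance] frobeniusInnerProductSpace

variable {m : Type*} [Fintype m] [DecidableEq m]
variable {E : Type*} [NormedAddCommGroup E] [InnerProductSpace ℝ E] [FiniteDimensional ℝ E]
  [MeasurableSpace E] [BorelSpace E]
variable {ι : Type*} [Fintype ι] [LinearOrder ι]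

omit [FiniteDimensional ℝ E] [MeasurableSpace E] [BorelSpace E] in
/-- **Pointwise form of the obvious bound.** For a cut-off `φ ∈ C²` whose derivatives of order
`1, 2` vanish off the annulus `U = B̄_{2r}(x₀) ∖ B_r(x₀)` and satisfy `‖Dφ‖ ≤ c₁/r`,
`‖D²φ‖ ≤ c₂/r²`, the stress weight of (2.9) is pointwise bounded by the energy density on the
annulus: `|∑ᵢⱼ S_{ij}(2Xᵢ∂ⱼφ + ½r²∂ᵢ∂ⱼφ)| ≤ 40 (4c₁ + 2c₂) 𝟙_U e` (four-dimensional frame).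
[cite: Waldron2019, §2 (2.7)] -/
theorem abs_stressWeight_le_indicator (b : OrthonormalBasis ι ℝ E) (hι : Fintype.card ι = 4)
    (A : Connection E (Matrix m m ℂ)) {φ : E → ℝ} (hφ : ContDiff ℝ 2 φ) (x₀ : E)
    {r c₁ c₂ : ℝ} (hr : 0 < r)
    (hvan : ∀ n, 1 ≤ n → ∀ y, dist y x₀ < r ∨ 2 * r < dist y x₀ → iteratedFDeriv ℝ n φ y = 0)
    (hD1 : ∀ y, ‖iteratedFDeriv ℝ 1 φ y‖ ≤ c₁ / r) (hD2 : ∀ y, ‖iteratedFDeriv ℝ 2 φ y‖ ≤ c₂ / r ^ 2)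
    (y : E) :
    |∑ i, ∑ j, ymStressEnergyOfBasis b A y i j *
        (2 * ⟪y - x₀, b i⟫ * fderiv ℝ φ y (b j) +
          2⁻¹ * ‖y - x₀‖ ^ 2 * fderiv ℝ (fun z => fderiv ℝ φ z (b j)) y (b i))| ≤
      40 * (4 * c₁ + 2 * c₂) *
        (closedBall x₀ (2 * r) \ ball x₀ r).indicator (fun y => ymDensityOfBasis b A y) y := by
  set U : Set E := closedBall x₀ (2 * r) \ ball x₀ r with hU
  set e : ℝ := ymDensityOfBasis b A y with he
  have he0 : 0 ≤ e := ymDensityOfBasis_nonneg b A y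
  have hbn : ∀ i, ‖b i‖ = 1 := fun i => b.orthonormal.1 i
  -- the directional derivatives in terms of iterated derivatives
  have hd1 : ∀ j, |fderiv ℝ φ y (b j)| ≤ ‖iteratedFDeriv ℝ 1 φ y‖ := fun j => by
    simpa [hbn j] using abs_fderiv_apply_le_norm_iteratedFDeriv_one φ y (b j)
  have hd2 : ∀ i j, |fderiv ℝ (fun z => fderiv ℝ φ z (b j)) y (b i)| ≤ ‖iteratedFDeriv ℝ 2 φ y‖ :=
    fun i j => by
      simpa [hbn i, hbn j] using abs_fderiv_fderiv_apply_le_norm_iteratedFDeriv_two hφ y (b i) (b j)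
  by_cases hy : y ∈ U
  · -- on the annulus: `|X_i| ≤ 2r`, `|∂φ| ≤ c₁/r`, `r_y² ≤ 4r²`, `|∂²φ| ≤ c₂/r²`
    rw [indicator_of_mem hy]
    have hdist : ‖y - x₀‖ ≤ 2 * r := by rw [← dist_eq_norm]; exact mem_closedBall.mp hy.1
    have hX : ∀ i, |⟪y - x₀, b i⟫| ≤ 2 * r := fun i =>
      (abs_real_inner_le_norm _ _).trans (by rw [hbn i, mul_one]; exact hdist)
    have hφ1 : ∀ j, |fderiv ℝ φ y (b j)| ≤ c₁ / r := fun j => (hd1 j).trans (hD1 y)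
    have hφ2 : ∀ i j, |fderiv ℝ (fun z => fderiv ℝ φ z (b j)) y (b i)| ≤ c₂ / r ^ 2 :=
      fun i j => (hd2 i j).trans (hD2 y)
    have hq : ∀ i j, |2 * ⟪y - x₀, b i⟫ * fderiv ℝ φ y (b j) +
        2⁻¹ * ‖y - x₀‖ ^ 2 * fderiv ℝ (fun z => fderiv ℝ φ z (b j)) y (b i)| ≤ 4 * c₁ + 2 * c₂ := by
      intro i j
      have h1 : |2 * ⟪y - x₀, b i⟫ * fderiv ℝ φ y (b j)| ≤ 4 * c₁ := by
        rw [abs_mul, abs_mul, abs_two]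
        calc 2 * |⟪y - x₀, b i⟫| * |fderiv ℝ φ y (b j)| ≤ 2 * (2 * r) * (c₁ / r) := by
              gcongr
              · exact hX i
              · exact hφ1 j
          _ = 4 * c₁ := by field_simp; ring
      have h2 : |2⁻¹ * ‖y - x₀‖ ^ 2 * fderiv ℝ (fun z => fderiv ℝ φ z (b j)) y (b i)| ≤ 2 * c₂ := by
        rw [abs_mul, abs_mul, abs_of_pos (by norm_num : (0 : ℝ) < 2⁻¹), abs_of_nonneg (sq_nonneg _)]
        calc 2⁻¹ * ‖y - x₀‖ ^ 2 * |fderiv ℝ (fun z => fderiv ℝ φ z (b j)) y (b i)|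
            ≤ 2⁻¹ * (2 * r) ^ 2 * (c₂ / r ^ 2) := by
              gcongr
              exact hφ2 i j
          _ = 2 * c₂ := by field_simp
      exact (abs_add_le _ _).trans (by linarith)
    have hS : ∀ i j, |ymStressEnergyOfBasis b A y i j| ≤ 5 / 2 * e := fun i j =>
      abs_ymStressEnergyOfBasis_le b A y i j
    calc |∑ i, ∑ j, ymStressEnergyOfBasis b A y i j *
          (2 * ⟪y - x₀, b i⟫ * fderiv ℝ φ y (b j) +
            2⁻¹ * ‖y - x₀‖ ^ 2 * fderiv ℝ (fun z => fderiv ℝ φ z (b j)) y (b i))|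
        ≤ ∑ i, ∑ j, |ymStressEnergyOfBasis b A y i j *
          (2 * ⟪y - x₀, b i⟫ * fderiv ℝ φ y (b j) +
            2⁻¹ * ‖y - x₀‖ ^ 2 * fderiv ℝ (fun z => fderiv ℝ φ z (b j)) y (b i))| := by
          refine (Finset.abs_sum_le_sum_abs _ _).trans (Finset.sum_le_sum fun i _ => ?_)
          exact Finset.abs_sum_le_sum_abs _ _
      _ ≤ ∑ _i : ι, ∑ _j : ι, 5 / 2 * e * (4 * c₁ + 2 * c₂) := by
          refine Finset.sum_le_sum fun i _ => Finset.sum_le_sum fun j _ => ?_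
          rw [abs_mul]
          exact mul_le_mul (hS i j) (hq i j) (abs_nonneg _) (by positivity)
      _ = 40 * (4 * c₁ + 2 * c₂) * e := by
          simp only [Finset.sum_const, Finset.card_univ, hι, nsmul_eq_mul, Nat.cast_ofNat]
          ring
  · -- off the annulus the derivatives of `φ` vanish
    rw [indicator_of_notMem hy, mul_zero]
    have hy' : dist y x₀ < r ∨ 2 * r < dist y x₀ := by
      by_contra hcon
      push Not at hcon
      exact hy ⟨mem_closedBall.mpr hcon.2, fun hb => (not_lt.mpr hcon.1) (mem_ball.mp hb)⟩
    have h1 : ∀ j, fderiv ℝ φ y (b j) = 0 := fun j => by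
      have := hvan 1 le_rfl y hy'
      rw [← iteratedFDeriv_one_apply (𝕜 := ℝ) (f := φ) (fun _ => b j)]
      simp [this]
    have h2 : ∀ i j, fderiv ℝ (fun z => fderiv ℝ φ z (b j)) y (b i) = 0 := fun i j => by
      rw [fderiv_fderiv_apply_eq_iteratedFDeriv_two hφ, hvan 2 (by norm_num) y hy']
      rfl
    rw [abs_nonpos_iff]
    refine Finset.sum_eq_zero fun i _ => Finset.sum_eq_zero fun j _ => ?_
    rw [h1 j, h2 i j]
    ring

/-- **The obvious bound (2.7).** For a jointly smooth time-dependent connection on the slab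
`𝒯 × E` (`dim E = 4`) and a cut-off `φ` as in `abs_stressWeight_le_indicator` (in particular the
scaled cut-offs `φ_{x₀,r}` of `exists_smooth_cutoff_family`), the stress term of the weighted
identity (2.9) satisfies
`|S(φ, τ₁, τ₂)| = |4∫_{τ₁}^{τ₂}∫ ∑ᵢⱼ S_{ij}(2Xᵢ∂ⱼφ + ½r²∂ᵢ∂ⱼφ)| ≤ C ∫_{τ₁}^{τ₂}∫_{U_r^{2r}} |F|²`
with `U_r^{2r} = B̄_{2r}(x₀) ∖ B_r(x₀)` and `C = 160 (4c₁ + 2c₂)`. [cite: Waldron2019, §2 (2.7)] -/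
theorem abs_stressWeight_integral_le (b : OrthonormalBasis ι ℝ E) (hι : Fintype.card ι = 4)
    {A : ℝ → Connection E (Matrix m m ℂ)} {𝒯 : Set ℝ} (h𝒯 : IsOpen 𝒯)
    (hA : ContDiffOn ℝ ∞ (fun p : ℝ × E => A p.1 p.2) (𝒯 ×ˢ (univ : Set E)))
    {φ : E → ℝ} (hφ : ContDiff ℝ 2 φ) (x₀ : E)
    {r c₁ c₂ : ℝ} (hr : 0 < r) (hc₁ : 0 ≤ c₁) (hc₂ : 0 ≤ c₂)
    (hvan : ∀ n, 1 ≤ n → ∀ y, dist y x₀ < r ∨ 2 * r < dist y x₀ → iteratedFDeriv ℝ n φ y = 0)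
    (hD1 : ∀ y, ‖iteratedFDeriv ℝ 1 φ y‖ ≤ c₁ / r) (hD2 : ∀ y, ‖iteratedFDeriv ℝ 2 φ y‖ ≤ c₂ / r ^ 2)
    {τ₁ τ₂ : ℝ} (h12 : τ₁ ≤ τ₂) (hsub : Icc τ₁ τ₂ ⊆ 𝒯) :
    |4 * ∫ s in τ₁..τ₂, ∫ y, ∑ i, ∑ j, ymStressEnergyOfBasis b (A s) y i j *
        (2 * ⟪y - x₀, b i⟫ * fderiv ℝ φ y (b j) +
          2⁻¹ * ‖y - x₀‖ ^ 2 * fderiv ℝ (fun z => fderiv ℝ φ z (b j)) y (b i))| ≤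
      160 * (4 * c₁ + 2 * c₂) * ∫ s in τ₁..τ₂,
        ∫ y in closedBall x₀ (2 * r) \ ball x₀ r, ymDensityOfBasis b (A s) y := by
  set U : Set E := closedBall x₀ (2 * r) \ ball x₀ r with hU
  have hUm : MeasurableSet U := measurableSet_closedBall.diff measurableSet_ball
  have hUK : U ⊆ closedBall x₀ (2 * r) := fun _ hy => hy.1
  set C : ℝ := 40 * (4 * c₁ + 2 * c₂) with hC
  have hC0 : 0 ≤ C := by positivity
  set w : ℝ → E → ℝ := fun s y => ∑ i, ∑ j, ymStressEnergyOfBasis b (A s) y i j *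
    (2 * ⟪y - x₀, b i⟫ * fderiv ℝ φ y (b j) +
      2⁻¹ * ‖y - x₀‖ ^ 2 * fderiv ℝ (fun z => fderiv ℝ φ z (b j)) y (b i)) with hw
  set e : ℝ × E → ℝ := fun p => ymDensityOfBasis b (A p.1) p.2 with he
  have he_c : ContinuousOn e (𝒯 ×ˢ (univ : Set E)) :=
    (contDiffOn_ymDensityOfBasis_joint_on b h𝒯 hA ENat.LEInfty.out).continuousOn
  have hslice : ∀ {s : ℝ}, s ∈ 𝒯 → Continuous fun y => e (s, y) := fun hs =>
    continuousOn_univ.mp (he_c.comp (continuous_const.prodMk continuous_id).continuousOn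
      fun y _ => ⟨hs, mem_univ y⟩)
  -- pointwise bound
  have hpt : ∀ s y, |w s y| ≤ C * U.indicator (fun y => e (s, y)) y := fun s y =>
    abs_stressWeight_le_indicator b hι (A s) hφ x₀ hr hvan hD1 hD2 y
  -- the spatial bound at each time of the slab
  have hinner : ∀ s ∈ 𝒯, |∫ y, w s y| ≤ C * ∫ y in U, e (s, y) := by
    intro s hs
    have hint : Integrable fun y => C * U.indicator (fun y => e (s, y)) y := by
      refine Integrable.const_mul ?_ C
      rw [integrable_indicator_iff hUm]
      exact ((hslice hs).continuousOn.integrableOn_compact (isCompact_closedBall x₀ (2 * r))).mono_set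
        hUK
    have h := norm_integral_le_of_norm_le hint (ae_of_all _ fun y => by
      rw [Real.norm_eq_abs]; exact hpt s y)
    rw [Real.norm_eq_abs, integral_const_mul, integral_indicator hUm] at h
    exact h
  -- integrate in time
  have hbound_t : IntervalIntegrable (fun s => C * ∫ y in U, e (s, y)) volume τ₁ τ₂ :=
    (intervalIntegrable_setIntegral_of_continuousOn (isCompact_closedBall x₀ (2 * r)) hUK he_c
      h12 hsub).const_mul C
  have houter : |∫ s in τ₁..τ₂, ∫ y, w s y| ≤ C * ∫ s in τ₁..τ₂, ∫ y in U, e (s, y) := by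
    have h := intervalIntegral.norm_integral_le_of_norm_le (f := fun s => ∫ y, w s y)
      (μ := volume) h12 (ae_of_all _ fun s hs => by
        rw [Real.norm_eq_abs]; exact hinner s (hsub ⟨hs.1.le, hs.2⟩)) hbound_t
    rw [Real.norm_eq_abs, intervalIntegral.integral_const_mul] at h
    exact h
  calc |4 * ∫ s in τ₁..τ₂, ∫ y, w s y| = 4 * |∫ s in τ₁..τ₂, ∫ y, w s y| := by
        rw [abs_mul, abs_of_pos (by norm_num : (0 : ℝ) < 4)]
    _ ≤ 4 * (C * ∫ s in τ₁..τ₂, ∫ y in U, e (s, y)) := by gcongr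
    _ = 160 * (4 * c₁ + 2 * c₂) * ∫ s in τ₁..τ₂, ∫ y in U, e (s, y) := by rw [hC]; ring

end ObviousBoundFlow

/-! ### Lemma 2.1: concentration forces dissipation -/

section SliceContinuity

variable {X : Type*} [TopologicalSpace X]

/-- Slices `y ↦ f(s, y)` of a slab-continuous function are continuous. [folklore] -/
theorem continuous_slice_of_continuousOn_slab {𝒯 : Set ℝ} {f : ℝ × X → ℝ}
    (hf : ContinuousOn f (𝒯 ×ˢ (univ : Set X))) {s : ℝ} (hs : s ∈ 𝒯) :
    Continuous fun y => f (s, y) :=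
  continuousOn_univ.mp (hf.comp (continuous_const.prodMk continuous_id).continuousOn
    fun y _ => ⟨hs, mem_univ y⟩)

end SliceContinuity


section IllustrativeLemma

open scoped Matrix.Norms.Frobenius

attribute [local instance] frobeniusInnerProductSpace

variable {m : Type*} [Fintype m] [DecidableEq m]
variable {E : Type*} [NormedAddCommGroup E] [InnerProductSpace ℝ E] [FiniteDimensional ℝ E]
  [MeasurableSpace E] [BorelSpace E]
variable {ι : Type*} [Fintype ι] [LinearOrder ι]

omit [MeasurableSpace E] [BorelSpace E] [LinearOrder ι] in
/-- **Joint continuity of the dissipation density** `∑ⱼ ‖(div_A F)_j‖²` along a jointly smooth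
solution of the flow (it is `∑ⱼ ‖Ȧ_j‖²`, read off the joint derivative). [folklore] -/
theorem continuousOn_dissipation_of_flow_on (b : OrthonormalBasis ι ℝ E)
    {A : ℝ → Connection E (Matrix m m ℂ)} {𝒯 : Set ℝ} (h𝒯 : IsOpen 𝒯)
    (hA : ContDiffOn ℝ ∞ (fun p : ℝ × E => A p.1 p.2) (𝒯 ×ˢ (univ : Set E)))
    (hpde : ∀ ⦃s : ℝ⦄, s ∈ 𝒯 → ∀ y w, deriv (fun s' => A s' y w) s = divCurvature (A s) y w) :
    ContinuousOn (fun p : ℝ × E => ∑ j, ‖divCurvature (A p.1) p.2 (b j)‖ ^ 2)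
      (𝒯 ×ˢ (univ : Set E)) := by
  have hU : IsOpen (𝒯 ×ˢ (univ : Set E)) := h𝒯.prod isOpen_univ
  have h1 := hA.continuousOn_fderiv_of_isOpen hU ENat.LEInfty.out
  have hG : ContinuousOn (fun p : ℝ × E =>
      ∑ j, ‖fderiv ℝ (fun q : ℝ × E => A q.1 q.2) p ((1 : ℝ), (0 : E)) (b j)‖ ^ 2)
      (𝒯 ×ˢ (univ : Set E)) := by
    refine continuousOn_finsetSum _ fun j _ => ?_
    exact (continuous_norm.comp_continuousOn
      ((h1.clm_apply continuousOn_const).clm_apply continuousOn_const)).pow 2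
  refine hG.congr ?_
  rintro ⟨s, y⟩ hp
  simp only
  refine Finset.sum_congr rfl fun j _ => ?_
  rw [norm_divCurvature_eq_of_flow_on h𝒯 hA (by simp) hp.1 y (b j) (hpde hp.1 y (b j))]

/-- **Waldron's Lemma 2.1** (illustrative lemma: "if all of the curvature concentrates from scale
`λ₁` to the smaller scale `λ₂`, then a small amount must dissipate"), flat setting, with
`|F|² = ∑_{i<j}‖F_{ij}‖²`, `|D^*F|² = ∑ⱼ‖(div F)_j‖²`, balls `B_ρ = B_ρ(x₀)`, annuli
`U_λ^ρ = B̄_ρ ∖ B_λ`. Let `A` be a jointly smooth `𝔲(m)`-valued solution of the Yang–Mills heat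
equation on the open time set `𝒯 ⊇ [τ₁, τ₂]` over a four-dimensional `E`, let
`0 < ε ≤ E`, `λ₁ > 0`, `λ₂ = (λ₁/10)√(ε/E)`, and let `φ` be a `C²` cut-off for `B̄_{λ₁} ⊂ B_{2λ₁}`
(`0 ≤ φ ≤ 1`, `φ = 1` on `B̄_{λ₁}`, `φ = 0` off `B_{2λ₁}`) with stress term
`S(φ, τ₁, τ₂) = 4∫_{τ₁}^{τ₂}∫ ∑ᵢⱼ S_{ij}(2Xᵢ∂ⱼφ + ½r²∂ᵢ∂ⱼφ)` (cf. (2.6), (2.9)). Assume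
`∫_{B_{λ₂}} |F(τ₂)|² ≤ E`, `∫_{U_{λ₁/2}^{λ₁}} |F(τ₁)|² ≥ ε`, `∫_{U_{λ₂}^{2λ₁}} |F(τ₂)|² ≤ ε/100` and
`S(φ, τ₁, τ₂) ≥ −ελ₁²/100`. Then `∫_{τ₁}^{τ₂}∫_{B_{2λ₁}} |D^*F|² > ε/100`. Proof: direct from the
weighted identity (2.9) (`weightedEnergy_rsq_identity_of_flow_on`) with this `φ`: the left side
at `τ₂` is at most `λ₂²E + 4λ₁²ε/100 = 5ελ₁²/100`, the right side at `τ₁` is at least `λ₁²ε/4`,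
so `2∫∫|D^*F|²φr² ≥ 19ελ₁²/100`, while `φ r² ≤ 4λ₁² 𝟙_{B_{2λ₁}}`.
[cite: Waldron2019, Lemma 2.1] -/
theorem Waldron2019_lemma_2_1 (b : OrthonormalBasis ι ℝ E) (hι : Fintype.card ι = 4)
    {A : ℝ → Connection E (Matrix m m ℂ)} {𝒯 : Set ℝ} (h𝒯 : IsOpen 𝒯)
    (hA : ContDiffOn ℝ ∞ (fun p : ℝ × E => A p.1 p.2) (𝒯 ×ˢ (univ : Set E)))
    (hval : ∀ ⦃s : ℝ⦄, s ∈ 𝒯 → (A s).IsValuedIn (skewAdjoint.submodule ℝ (Matrix m m ℂ)))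
    (hpde : ∀ ⦃s : ℝ⦄, s ∈ 𝒯 → ∀ y w, deriv (fun s' => A s' y w) s = divCurvature (A s) y w)
    {φ : E → ℝ} (hφ : ContDiff ℝ 2 φ) (hφc : HasCompactSupport φ) {x₀ : E} {lam₁ : ℝ}
    (hlam₁ : 0 < lam₁) (hφ01 : ∀ y, 0 ≤ φ y ∧ φ y ≤ 1) (hφ1 : ∀ y, dist y x₀ ≤ lam₁ → φ y = 1)
    (hφ0 : ∀ y, 2 * lam₁ ≤ dist y x₀ → φ y = 0)
    {τ₁ τ₂ : ℝ} (h12 : τ₁ ≤ τ₂) (hsub : Icc τ₁ τ₂ ⊆ 𝒯) {ε E₀ : ℝ} (hε : 0 < ε) (hεE : ε ≤ E₀)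
    (h1 : ∫ y in ball x₀ (lam₁ / 10 * √(ε / E₀)), ymDensityOfBasis b (A τ₂) y ≤ E₀)
    (h2 : ε ≤ ∫ y in closedBall x₀ lam₁ \ ball x₀ (lam₁ / 2), ymDensityOfBasis b (A τ₁) y)
    (h3 : ∫ y in closedBall x₀ (2 * lam₁) \ ball x₀ (lam₁ / 10 * √(ε / E₀)),
        ymDensityOfBasis b (A τ₂) y ≤ ε / 100)
    (h4 : -(ε * lam₁ ^ 2 / 100) ≤ 4 * ∫ s in τ₁..τ₂, ∫ y, ∑ i, ∑ j,
        ymStressEnergyOfBasis b (A s) y i j *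
          (2 * ⟪y - x₀, b i⟫ * fderiv ℝ φ y (b j) +
            2⁻¹ * ‖y - x₀‖ ^ 2 * fderiv ℝ (fun z => fderiv ℝ φ z (b j)) y (b i))) :
    ε / 100 < ∫ s in τ₁..τ₂, ∫ y in ball x₀ (2 * lam₁), ∑ j, ‖divCurvature (A s) y (b j)‖ ^ 2 := by
  -- the identity (2.9)
  have hid := weightedEnergy_rsq_identity_of_flow_on b hι h𝒯 hA hval hpde hφ hφc x₀ h12 hsub
  -- scales
  have hE₀ : 0 < E₀ := hε.trans_le hεE
  set lam₂ : ℝ := lam₁ / 10 * √(ε / E₀) with hlam₂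
  have hsq : √(ε / E₀) ^ 2 = ε / E₀ := Real.sq_sqrt (div_pos hε hE₀).le
  have hsqrt1 : √(ε / E₀) ≤ 1 := Real.sqrt_le_one.mpr ((div_le_one hE₀).mpr hεE)
  have hlam₂1 : lam₂ ≤ lam₁ / 10 := by
    rw [hlam₂]
    exact mul_le_of_le_one_right (by positivity) hsqrt1
  have hlam₂2 : lam₂ ≤ 2 * lam₁ := by linarith
  have hlam₂sq : lam₂ ^ 2 * E₀ = ε * lam₁ ^ 2 / 100 := by
    rw [hlam₂, mul_pow, hsq]
    field_simp
    norm_num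
  -- continuity of the densities
  have hτ₁ : τ₁ ∈ 𝒯 := hsub ⟨le_rfl, h12⟩
  have hτ₂ : τ₂ ∈ 𝒯 := hsub ⟨h12, le_rfl⟩
  have he_c : ContinuousOn (fun p : ℝ × E => ymDensityOfBasis b (A p.1) p.2) (𝒯 ×ˢ univ) :=
    (contDiffOn_ymDensityOfBasis_joint_on b h𝒯 hA ENat.LEInfty.out).continuousOn
  have hDis_c : ContinuousOn (fun p : ℝ × E => ∑ j, ‖divCurvature (A p.1) p.2 (b j)‖ ^ 2)
      (𝒯 ×ˢ univ) := continuousOn_dissipation_of_flow_on b h𝒯 hA hpde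
  have hslice : ∀ {f : ℝ × E → ℝ}, ContinuousOn f (𝒯 ×ˢ univ) → ∀ {s : ℝ}, s ∈ 𝒯 →
      Continuous fun y => f (s, y) := fun hf s hs =>
    continuousOn_univ.mp (hf.comp (continuous_const.prodMk continuous_id).continuousOn
      fun y _ => ⟨hs, mem_univ y⟩)
  have he₁c : Continuous fun y => ymDensityOfBasis b (A τ₁) y := hslice he_c hτ₁
  have he₂c : Continuous fun y => ymDensityOfBasis b (A τ₂) y := hslice he_c hτ₂
  have he0 : ∀ s y, 0 ≤ ymDensityOfBasis b (A s) y := fun s y => ymDensityOfBasis_nonneg b _ y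
  have hDis0 : ∀ s y, 0 ≤ ∑ j, ‖divCurvature (A s) y (b j)‖ ^ 2 := fun s y =>
    Finset.sum_nonneg fun j _ => by positivity
  have hφ0' : ∀ y, 0 ≤ φ y := fun y => (hφ01 y).1
  have hφ1' : ∀ y, φ y ≤ 1 := fun y => (hφ01 y).2
  have hφc_c : Continuous φ := hφ.continuous
  have hr_c : Continuous fun y : E => ‖y - x₀‖ ^ 2 := (continuous_id.sub continuous_const).norm.pow 2
  -- integrability over subsets of the big ball
  have hKc : IsCompact (closedBall x₀ (2 * lam₁)) := isCompact_closedBall _ _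
  have hInt : ∀ {f : E → ℝ}, Continuous f → ∀ {U : Set E}, U ⊆ closedBall x₀ (2 * lam₁) →
      IntegrableOn f U := fun hf U hU =>
    (hf.continuousOn.integrableOn_compact hKc).mono_set hU
  have hb2 : ball x₀ lam₂ ⊆ closedBall x₀ (2 * lam₁) :=
    ball_subset_closedBall.trans (closedBall_subset_closedBall hlam₂2)
  -- (a) the weighted energy at `τ₂` is small
  have hI₂ : ∫ y, φ y * ‖y - x₀‖ ^ 2 * ymDensityOfBasis b (A τ₂) y ≤ 5 * (ε * lam₁ ^ 2 / 100) := by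
    have hsplit : closedBall x₀ (2 * lam₁) =
        ball x₀ lam₂ ∪ (closedBall x₀ (2 * lam₁) \ ball x₀ lam₂) := (union_sdiff_cancel hb2).symm
    have hf : Continuous fun y => φ y * ‖y - x₀‖ ^ 2 * ymDensityOfBasis b (A τ₂) y :=
      (hφc_c.mul hr_c).mul he₂c
    have hzero : ∀ y ∉ closedBall x₀ (2 * lam₁),
        φ y * ‖y - x₀‖ ^ 2 * ymDensityOfBasis b (A τ₂) y = 0 := by
      intro y hy
      rw [hφ0 y (le_of_lt (not_le.mp (mt mem_closedBall.mpr hy))), zero_mul, zero_mul]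
    rw [← setIntegral_eq_integral_of_forall_compl_eq_zero hzero, hsplit,
      setIntegral_union disjoint_sdiff_right (measurableSet_closedBall.diff measurableSet_ball)
        (hInt hf hb2) (hInt hf fun _ hy => hy.1)]
    have hA' : ∫ y in ball x₀ lam₂, φ y * ‖y - x₀‖ ^ 2 * ymDensityOfBasis b (A τ₂) y ≤
        lam₂ ^ 2 * E₀ := by
      calc ∫ y in ball x₀ lam₂, φ y * ‖y - x₀‖ ^ 2 * ymDensityOfBasis b (A τ₂) y
          ≤ ∫ y in ball x₀ lam₂, lam₂ ^ 2 * ymDensityOfBasis b (A τ₂) y := by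
            refine setIntegral_mono_on (hInt hf hb2) (hInt (continuous_const.mul he₂c) hb2)
              measurableSet_ball fun y hy => ?_
            have hd : ‖y - x₀‖ ^ 2 ≤ lam₂ ^ 2 := by
              rw [← dist_eq_norm]
              exact pow_le_pow_left₀ dist_nonneg (mem_ball.mp hy).le 2
            calc φ y * ‖y - x₀‖ ^ 2 * ymDensityOfBasis b (A τ₂) y
                ≤ 1 * lam₂ ^ 2 * ymDensityOfBasis b (A τ₂) y := by
                  gcongr
                  · exact he0 τ₂ y
                  · exact hφ1' y
              _ = lam₂ ^ 2 * ymDensityOfBasis b (A τ₂) y := by ring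
        _ = lam₂ ^ 2 * ∫ y in ball x₀ lam₂, ymDensityOfBasis b (A τ₂) y := integral_const_mul _ _
        _ ≤ lam₂ ^ 2 * E₀ := mul_le_mul_of_nonneg_left h1 (sq_nonneg _)
    have hB' : ∫ y in closedBall x₀ (2 * lam₁) \ ball x₀ lam₂,
        φ y * ‖y - x₀‖ ^ 2 * ymDensityOfBasis b (A τ₂) y ≤ 4 * lam₁ ^ 2 * (ε / 100) := by
      calc ∫ y in closedBall x₀ (2 * lam₁) \ ball x₀ lam₂,
            φ y * ‖y - x₀‖ ^ 2 * ymDensityOfBasis b (A τ₂) y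
          ≤ ∫ y in closedBall x₀ (2 * lam₁) \ ball x₀ lam₂,
              4 * lam₁ ^ 2 * ymDensityOfBasis b (A τ₂) y := by
            refine setIntegral_mono_on (hInt hf fun _ hy => hy.1)
              (hInt (continuous_const.mul he₂c) fun _ hy => hy.1)
              (measurableSet_closedBall.diff measurableSet_ball) fun y hy => ?_
            have hd : ‖y - x₀‖ ^ 2 ≤ (2 * lam₁) ^ 2 := by
              rw [← dist_eq_norm]
              exact pow_le_pow_left₀ dist_nonneg (mem_closedBall.mp hy.1) 2
            calc φ y * ‖y - x₀‖ ^ 2 * ymDensityOfBasis b (A τ₂) y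
                ≤ 1 * (2 * lam₁) ^ 2 * ymDensityOfBasis b (A τ₂) y := by
                  gcongr
                  · exact he0 τ₂ y
                  · exact hφ1' y
              _ = 4 * lam₁ ^ 2 * ymDensityOfBasis b (A τ₂) y := by ring
        _ = 4 * lam₁ ^ 2 * ∫ y in closedBall x₀ (2 * lam₁) \ ball x₀ lam₂,
              ymDensityOfBasis b (A τ₂) y := integral_const_mul _ _
        _ ≤ 4 * lam₁ ^ 2 * (ε / 100) := mul_le_mul_of_nonneg_left h3 (by positivity)
    rw [hlam₂sq] at hA'
    linarith
  -- (b) the weighted energy at `τ₁` is large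
  have hI₁ : lam₁ ^ 2 / 4 * ε ≤ ∫ y, φ y * ‖y - x₀‖ ^ 2 * ymDensityOfBasis b (A τ₁) y := by
    have hf : Continuous fun y => φ y * ‖y - x₀‖ ^ 2 * ymDensityOfBasis b (A τ₁) y :=
      (hφc_c.mul hr_c).mul he₁c
    have hfi : Integrable fun y => φ y * ‖y - x₀‖ ^ 2 * ymDensityOfBasis b (A τ₁) y :=
      hf.integrable_of_hasCompactSupport (hφc.mul_right.mul_right)
    have hnn : ∀ y, 0 ≤ φ y * ‖y - x₀‖ ^ 2 * ymDensityOfBasis b (A τ₁) y := fun y =>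
      mul_nonneg (mul_nonneg (hφ0' y) (sq_nonneg _)) (he0 τ₁ y)
    calc lam₁ ^ 2 / 4 * ε
        ≤ lam₁ ^ 2 / 4 * ∫ y in closedBall x₀ lam₁ \ ball x₀ (lam₁ / 2),
            ymDensityOfBasis b (A τ₁) y := mul_le_mul_of_nonneg_left h2 (by positivity)
      _ = ∫ y in closedBall x₀ lam₁ \ ball x₀ (lam₁ / 2),
            lam₁ ^ 2 / 4 * ymDensityOfBasis b (A τ₁) y := (integral_const_mul _ _).symm
      _ ≤ ∫ y in closedBall x₀ lam₁ \ ball x₀ (lam₁ / 2),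
            φ y * ‖y - x₀‖ ^ 2 * ymDensityOfBasis b (A τ₁) y := by
          refine setIntegral_mono_on
            (hInt (continuous_const.mul he₁c) (fun _ hy => closedBall_subset_closedBall
              (by linarith) hy.1))
            (hInt hf (fun _ hy => closedBall_subset_closedBall (by linarith) hy.1))
            (measurableSet_closedBall.diff measurableSet_ball) fun y hy => ?_
          have hφy : φ y = 1 := hφ1 y (mem_closedBall.mp hy.1)
          have hd : (lam₁ / 2) ^ 2 ≤ ‖y - x₀‖ ^ 2 := by
            rw [← dist_eq_norm]
            exact pow_le_pow_left₀ (by positivity) (not_lt.mp (mt mem_ball.mpr hy.2)) 2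
          rw [hφy, one_mul]
          calc lam₁ ^ 2 / 4 * ymDensityOfBasis b (A τ₁) y
              = (lam₁ / 2) ^ 2 * ymDensityOfBasis b (A τ₁) y := by ring
            _ ≤ ‖y - x₀‖ ^ 2 * ymDensityOfBasis b (A τ₁) y :=
                mul_le_mul_of_nonneg_right hd (he0 τ₁ y)
      _ ≤ ∫ y, φ y * ‖y - x₀‖ ^ 2 * ymDensityOfBasis b (A τ₁) y :=
          setIntegral_le_integral hfi (ae_of_all _ hnn)
  -- (c) the weighted dissipation is dominated by the dissipation on `B_{2λ₁}`
  have hDw : ∫ s in τ₁..τ₂, ∫ y, φ y * ‖y - x₀‖ ^ 2 * ∑ j, ‖divCurvature (A s) y (b j)‖ ^ 2 ≤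
      4 * lam₁ ^ 2 * ∫ s in τ₁..τ₂, ∫ y in ball x₀ (2 * lam₁),
        ∑ j, ‖divCurvature (A s) y (b j)‖ ^ 2 := by
    have hc1 : Continuous fun p : ℝ × E => φ p.2 * ‖p.2 - x₀‖ ^ 2 :=
      (hφc_c.comp continuous_snd).mul (hr_c.comp continuous_snd)
    have hg_c : ContinuousOn (fun p : ℝ × E => φ p.2 * ‖p.2 - x₀‖ ^ 2 *
        ∑ j, ‖divCurvature (A p.1) p.2 (b j)‖ ^ 2) (𝒯 ×ˢ univ) := hc1.continuousOn.mul hDis_c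
    have hg0 : ∀ s, ∀ y ∉ closedBall x₀ (2 * lam₁),
        φ y * ‖y - x₀‖ ^ 2 * ∑ j, ‖divCurvature (A s) y (b j)‖ ^ 2 = 0 := by
      intro s y hy
      rw [hφ0 y (le_of_lt (not_le.mp (mt mem_closedBall.mpr hy))), zero_mul, zero_mul]
    have hf_t : IntervalIntegrable
        (fun s => ∫ y, φ y * ‖y - x₀‖ ^ 2 * ∑ j, ‖divCurvature (A s) y (b j)‖ ^ 2)
        volume τ₁ τ₂ :=
      intervalIntegrable_integral_of_continuousOn (g := fun p : ℝ × E => φ p.2 * ‖p.2 - x₀‖ ^ 2 *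
        ∑ j, ‖divCurvature (A p.1) p.2 (b j)‖ ^ 2) hKc hg_c hg0 h12 hsub
    have hg_t : IntervalIntegrable
        (fun s => 4 * lam₁ ^ 2 * ∫ y in ball x₀ (2 * lam₁), ∑ j, ‖divCurvature (A s) y (b j)‖ ^ 2)
        volume τ₁ τ₂ :=
      (intervalIntegrable_setIntegral_of_continuousOn
        (g := fun p : ℝ × E => ∑ j, ‖divCurvature (A p.1) p.2 (b j)‖ ^ 2) hKc
        ball_subset_closedBall hDis_c h12 hsub).const_mul _
    rw [← intervalIntegral.integral_const_mul]
    refine intervalIntegral.integral_mono_on h12 hf_t hg_t fun s hs => ?_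
    have hs𝒯 : s ∈ 𝒯 := hsub hs
    have hDs : Continuous fun y => ∑ j, ‖divCurvature (A s) y (b j)‖ ^ 2 := hslice hDis_c hs𝒯
    have hfs : Continuous fun y => φ y * ‖y - x₀‖ ^ 2 * ∑ j, ‖divCurvature (A s) y (b j)‖ ^ 2 :=
      (hφc_c.mul hr_c).mul hDs
    have hzero : ∀ y ∉ ball x₀ (2 * lam₁),
        φ y * ‖y - x₀‖ ^ 2 * ∑ j, ‖divCurvature (A s) y (b j)‖ ^ 2 = 0 := fun y hy => by
      rw [hφ0 y (not_lt.mp (mt mem_ball.mpr hy)), zero_mul, zero_mul]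
    rw [← setIntegral_eq_integral_of_forall_compl_eq_zero hzero, ← integral_const_mul]
    refine setIntegral_mono_on (hInt hfs ball_subset_closedBall)
      (hInt (continuous_const.mul hDs) ball_subset_closedBall) measurableSet_ball fun y hy => ?_
    have hd : ‖y - x₀‖ ^ 2 ≤ (2 * lam₁) ^ 2 := by
      rw [← dist_eq_norm]
      exact pow_le_pow_left₀ dist_nonneg (mem_ball.mp hy).le 2
    calc φ y * ‖y - x₀‖ ^ 2 * ∑ j, ‖divCurvature (A s) y (b j)‖ ^ 2
        ≤ 1 * (2 * lam₁) ^ 2 * ∑ j, ‖divCurvature (A s) y (b j)‖ ^ 2 := by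
          have h0 := hDis0 s y
          gcongr
          exact hφ1' y
      _ = 4 * lam₁ ^ 2 * ∑ j, ‖divCurvature (A s) y (b j)‖ ^ 2 := by ring
  -- (d) combine: `2∫∫|D^*F|²φr² ≥ 19ελ₁²/100` and `φ r² ≤ 4λ₁² 𝟙_{B_{2λ₁}}`
  have key : 19 * (ε * lam₁ ^ 2 / 100) ≤ 8 * lam₁ ^ 2 * ∫ s in τ₁..τ₂,
      ∫ y in ball x₀ (2 * lam₁), ∑ j, ‖divCurvature (A s) y (b j)‖ ^ 2 := by
    linarith
  have hl2 : 0 < lam₁ ^ 2 := by positivity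
  by_contra hcon
  push Not at hcon
  nlinarith [mul_le_mul_of_nonneg_left hcon (by positivity : (0 : ℝ) ≤ 8 * lam₁ ^ 2),
    mul_pos hε hl2]

/-- **Lemma 2.1 on the flat torus** ("In particular, if `M` is compact, then
`YM(τ₂) + ε/100 < YM(τ₁)`", Waldron 2019 (2.10)): for an `L`-periodic solution on `ℝ⁴` and a
ball `B_{2λ₁}(x₀)` contained in a period cell `Q = a + [0, L]⁴`, under the hypotheses of
`Waldron2019_lemma_2_1` the Yang–Mills energy `YM = ½ ∫_Q |F|²` of the cell drops by more than
`ε/100` between `τ₁` and `τ₂` (global energy identity on the cell,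
`ymEnergy_cell_sub_eq_of_flow_on`). [cite: Waldron2019, Lemma 2.1 (2.10)] -/
theorem Waldron2019_lemma_2_1_torus {L : ℝ} (hL : 0 ≤ L) (a : Fin 4 → ℝ)
    {A : ℝ → Connection (EuclideanSpace ℝ (Fin 4)) (Matrix m m ℂ)} {𝒯 : Set ℝ} (h𝒯 : IsOpen 𝒯)
    (hA : ContDiffOn ℝ ∞ (fun p : ℝ × EuclideanSpace ℝ (Fin 4) => A p.1 p.2) (𝒯 ×ˢ univ))
    (hper : ∀ s : ℝ, s ∈ 𝒯 → (A s).IsLatticePeriodic L)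
    (hval : ∀ ⦃s : ℝ⦄, s ∈ 𝒯 → (A s).IsValuedIn (skewAdjoint.submodule ℝ (Matrix m m ℂ)))
    (hpde : ∀ ⦃s : ℝ⦄, s ∈ 𝒯 → ∀ y w, deriv (fun s' => A s' y w) s = divCurvature (A s) y w)
    {φ : EuclideanSpace ℝ (Fin 4) → ℝ} (hφ : ContDiff ℝ 2 φ) (hφc : HasCompactSupport φ)
    {x₀ : EuclideanSpace ℝ (Fin 4)} {lam₁ : ℝ} (hlam₁ : 0 < lam₁)
    (hball : ball x₀ (2 * lam₁) ⊆ {y | WithLp.ofLp y ∈ Icc a (fun i => a i + L)})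
    (hφ01 : ∀ y, 0 ≤ φ y ∧ φ y ≤ 1) (hφ1 : ∀ y, dist y x₀ ≤ lam₁ → φ y = 1)
    (hφ0 : ∀ y, 2 * lam₁ ≤ dist y x₀ → φ y = 0)
    {τ₁ τ₂ : ℝ} (h12 : τ₁ ≤ τ₂) (hsub : Icc τ₁ τ₂ ⊆ 𝒯) {ε E₀ : ℝ} (hε : 0 < ε) (hεE : ε ≤ E₀)
    (h1 : ∫ y in ball x₀ (lam₁ / 10 * √(ε / E₀)),
        ymDensityOfBasis (EuclideanSpace.basisFun _ ℝ) (A τ₂) y ≤ E₀)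
    (h2 : ε ≤ ∫ y in closedBall x₀ lam₁ \ ball x₀ (lam₁ / 2),
        ymDensityOfBasis (EuclideanSpace.basisFun _ ℝ) (A τ₁) y)
    (h3 : ∫ y in closedBall x₀ (2 * lam₁) \ ball x₀ (lam₁ / 10 * √(ε / E₀)),
        ymDensityOfBasis (EuclideanSpace.basisFun _ ℝ) (A τ₂) y ≤ ε / 100)
    (h4 : -(ε * lam₁ ^ 2 / 100) ≤ 4 * ∫ s in τ₁..τ₂, ∫ y, ∑ i, ∑ j,
        ymStressEnergyOfBasis (EuclideanSpace.basisFun _ ℝ) (A s) y i j *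
          (2 * ⟪y - x₀, EuclideanSpace.basisFun _ ℝ i⟫ *
              fderiv ℝ φ y (EuclideanSpace.basisFun _ ℝ j) +
            2⁻¹ * ‖y - x₀‖ ^ 2 * fderiv ℝ (fun z => fderiv ℝ φ z (EuclideanSpace.basisFun _ ℝ j))
              y (EuclideanSpace.basisFun _ ℝ i))) :
    (∫ y in {y | WithLp.ofLp y ∈ Icc a (fun i => a i + L)},
        ymDensityOfBasis (EuclideanSpace.basisFun _ ℝ) (A τ₂) y) / 2 + ε / 100 <
      (∫ y in {y | WithLp.ofLp y ∈ Icc a (fun i => a i + L)},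
        ymDensityOfBasis (EuclideanSpace.basisFun _ ℝ) (A τ₁) y) / 2 := by
  set 𝔟 := EuclideanSpace.basisFun (Fin 4) ℝ with h𝔟
  set Q : Set (EuclideanSpace ℝ (Fin 4)) := {y | WithLp.ofLp y ∈ Icc a (fun i => a i + L)} with hQ
  -- dissipation on the ball exceeds `ε/100`
  have hlem := Waldron2019_lemma_2_1 𝔟 (Fintype.card_fin 4) h𝒯 hA hval hpde hφ hφc hlam₁ hφ01
    hφ1 hφ0 h12 hsub hε hεE h1 h2 h3 h4
  -- the global energy identity on the cell
  have hcell := ymEnergy_cell_sub_eq_of_flow_on (k := 3) hL a h𝒯 hA ENat.LEInfty.out hper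
    hval hpde h12 hsub
  -- dissipation on the ball is at most dissipation on the cell
  have hQc : IsCompact Q :=
    (PiLp.continuousLinearEquiv 2 ℝ (fun _ : Fin 4 => ℝ)).toHomeomorph.isCompact_preimage.mpr
      isCompact_Icc
  have hQm : MeasurableSet Q := hQc.isClosed.measurableSet
  have hDis_c : ContinuousOn (fun p : ℝ × EuclideanSpace ℝ (Fin 4) =>
      ∑ j, ‖divCurvature (A p.1) p.2 (𝔟 j)‖ ^ 2) (𝒯 ×ˢ univ) :=
    continuousOn_dissipation_of_flow_on 𝔟 h𝒯 hA hpde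
  have hmono : ∫ s in τ₁..τ₂, ∫ y in ball x₀ (2 * lam₁), ∑ j, ‖divCurvature (A s) y (𝔟 j)‖ ^ 2 ≤
      ∫ s in τ₁..τ₂, ∫ y in Q, ∑ j, ‖divCurvature (A s) y (𝔟 j)‖ ^ 2 := by
    refine intervalIntegral.integral_mono_on h12
      (intervalIntegrable_setIntegral_of_continuousOn hQc hball hDis_c h12 hsub)
      (intervalIntegrable_setIntegral_of_continuousOn hQc Subset.rfl hDis_c h12 hsub)
      fun s hs => ?_
    have hDs : Continuous fun y => ∑ j, ‖divCurvature (A s) y (𝔟 j)‖ ^ 2 :=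
      continuous_slice_of_continuousOn_slab hDis_c (hsub hs)
    have hiQ : IntegrableOn (fun y => ∑ j, ‖divCurvature (A s) y (𝔟 j)‖ ^ 2) Q :=
      hDs.continuousOn.integrableOn_compact hQc
    have h := setIntegral_mono_set (μ := volume) (s := ball x₀ (2 * lam₁)) (t := Q) hiQ
      (ae_of_all _ fun y => Finset.sum_nonneg fun j _ => by positivity)
      (ae_of_all _ hball)
    exact h
  linarith

end IllustrativeLemma

/-! ### The cut-off family of (2.6)–(2.7) -/

section CutoffPackage

open scoped Matrix.Norms.Frobenius

attribute [local instance] frobeniusInnerProductSpace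

variable {m : Type*} [Fintype m] [DecidableEq m]
variable {E : Type*} [NormedAddCommGroup E] [InnerProductSpace ℝ E] [FiniteDimensional ℝ E]
  [MeasurableSpace E] [BorelSpace E]
variable {ι : Type*} [Fintype ι] [LinearOrder ι]

/-- **Waldron's cut-offs `φ_λ` with the obvious bound (2.7).** There is a constant `C`
(depending only on the space `E`, through one fixed bump function) such that for every centre
`x₀` and scale `λ > 0` there is a smooth cut-off `φ_λ : E → [0, 1]` for `B̄_λ(x₀) ⊂ B_{2λ}(x₀)`,
compactly supported, whose stress term in the weighted identity (2.9) obeys, along every jointly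
smooth time-dependent connection on a slab `𝒯 × E` (`dim E = 4`) and every `[τ₁, τ₂] ⊆ 𝒯`,
`|S(φ_λ, τ₁, τ₂)| ≤ C ∫_{τ₁}^{τ₂}∫_{U_λ^{2λ}} |F|²` (`U_λ^{2λ} = B̄_{2λ} ∖ B_λ`). These are the
cut-offs to which `Waldron2019_lemma_2_1` and the curvature-scale arguments of §6 apply.
[cite: Waldron2019, §2 (2.6)–(2.7)] -/
theorem exists_cutoff_stressWeight_le (b : OrthonormalBasis ι ℝ E) (hι : Fintype.card ι = 4) :
    ∃ C : ℝ, 0 ≤ C ∧ ∀ (x₀ : E) (r : ℝ), 0 < r → ∃ φ : E → ℝ,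
      ContDiff ℝ ∞ φ ∧ HasCompactSupport φ ∧ (∀ y, 0 ≤ φ y ∧ φ y ≤ 1) ∧
      (∀ y, dist y x₀ ≤ r → φ y = 1) ∧ (∀ y, 2 * r ≤ dist y x₀ → φ y = 0) ∧
      ∀ {A : ℝ → Connection E (Matrix m m ℂ)} {𝒯 : Set ℝ}, IsOpen 𝒯 →
        ContDiffOn ℝ ∞ (fun p : ℝ × E => A p.1 p.2) (𝒯 ×ˢ (univ : Set E)) →
        ∀ {τ₁ τ₂ : ℝ}, τ₁ ≤ τ₂ → Icc τ₁ τ₂ ⊆ 𝒯 →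
          |4 * ∫ s in τ₁..τ₂, ∫ y, ∑ i, ∑ j, ymStressEnergyOfBasis b (A s) y i j *
              (2 * ⟪y - x₀, b i⟫ * fderiv ℝ φ y (b j) +
                2⁻¹ * ‖y - x₀‖ ^ 2 * fderiv ℝ (fun z => fderiv ℝ φ z (b j)) y (b i))| ≤
            C * ∫ s in τ₁..τ₂, ∫ y in closedBall x₀ (2 * r) \ ball x₀ r,
              ymDensityOfBasis b (A s) y := by
  obtain ⟨Φ, C, hC, hfam⟩ := Literature.Analysis.Calculus.exists_smooth_cutoff_family (E := E)
  refine ⟨160 * (4 * C 1 + 2 * C 2), by have := hC 1; have := hC 2; positivity,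
    fun x₀ r hr => ?_⟩
  obtain ⟨hsmooth, hnn, hle, hone, hzero, -, hcpt, hvan, -, hbound⟩ := hfam x₀ r hr
  refine ⟨Φ x₀ r, hsmooth, hcpt, fun y => ⟨hnn y, hle y⟩, hone, hzero,
    fun {A} {𝒯} h𝒯 hA {τ₁} {τ₂} h12 hsub => ?_⟩
  exact abs_stressWeight_integral_le b hι h𝒯 hA (hsmooth.of_le ENat.LEInfty.out) x₀ hr
    (hC 1) (hC 2) hvan (fun y => by simpa using hbound 1 y) (fun y => hbound 2 y) h12 hsub

end CutoffPackage

end Literature.MathematicalPhysics.QuantumLattice
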